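import Literature.Analysis.FluidPDE.PassiveVectorTensorWeakContinuity
import HarnessLib

/-!
# Weak passive solenoidal vectors with a constant viscosity tensor: the duality pairing with a
# solution of the ADJOINT (backward, transposed-tensor) problem is constant in time

Analysis/FluidPDE proof-support file (everything proved; no definitions, no named facts). Let `u` be
a weak solution of the class `Torus.IsWeakTensorPassiveVectorOn 0 T 𝔸 b u₀ u`
(`∂ₜu + (b·∇)u + ∇π = 𝓛_𝔸 u`, `∇·u = 0`, Frisch's anisotropic eddy viscosity (9.57)) and, for
`0 < t₀ ≤ T`, let `ψ` be a weak solution of the SAME class on `(0,t₀)` with the major transpose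
`𝔸ᵀ = Torus.majorTranspose 𝔸`, the time-reversed carrier `r ↦ −b(t₀ − r)` and datum `φ`
(`Torus.IsWeakTensorPassiveVectorOn 0 t₀ (majorTranspose 𝔸) (fun r => -b (t₀ - r)) φ ψ`): in the
variable `s = t₀ − r` this is the adjoint (backward) problem `−∂ₛψ − (b·∇)ψ + ∇π' = 𝓛_𝔸^* ψ`,
`ψ(s = t₀) = φ`. For a tensor in a Legendre–Hadamard window `NearIso 𝔸 lo hi`, `0 < lo`, an
essentially bounded carrier and `L²` weakly divergence-free data `u₀`, `φ`:

* `IsWeakTensorPassiveVectorOn.exists_ae_integral_inner_reversed_eq_const` — **the duality pairing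
  `s ↦ ∫⟪u(s), ψ(t₀ − s)⟫` is a.e. equal to a constant `c` on `(0,t₀)`.** Proof in Fourier–Galerkin
  form (the product rule `d/dt (u, v) = ⟨u', v⟩ + ⟨u, v'⟩` of Temam 1984, Ch. III Lemma 1.2,
  polarised, for the truncations): the tested modes `⟪û(s)(k), z⟫`, `⟪ψ̂(r)(k), z⟫` (`z ⊥ k`) are
  absolutely continuous (`PassiveVectorTensorFourier.ae_inner_mFourierCoeff_eq`, the one for `ψ`
  reflected in time); expanding in an orthonormal basis of `k^⊥` and using the product formula for
  complex primitives, `Σ_{|k|≤N} Re⟪û(s)(k), ψ̂(t₀−s)(k)⟫` is a primitive whose derivative is, for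
  a.e. `s`, the cross transport flux `∫⟪u,(b·∇)P_Nψ(t₀−·)⟫ + ∫⟪ψ(t₀−·),(b·∇)P_N u⟫` — the viscous
  terms cancel MODE BY MODE because the symbol matrix of `𝔸ᵀ` is the adjoint of that of `𝔸`
  (`inner_symbT_majorTranspose_left`), and no symmetry of `𝔸` is needed; by antisymmetry of the
  trilinear form the flux is a remainder
  `O(‖u − P_Nu‖₂‖∇P_Nψ‖₂ + ‖ψ − P_Nψ‖₂‖∇P_N u‖₂)` whose `L¹(0,t₀)` norm tends to `0` (Parseval tails,
  finite dissipations `PassiveVectorTensorDissipationBound.eVectorDissipation_lt_top`); Parseval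
  identifies the limit of the truncated pairings with `∫⟪u(s), ψ(t₀ − s)⟫` at a.e. `s`.
* `IsWeakTensorPassiveVectorOn.exists_const_ae_integral_inner_reversed_eq` — **the constant is the
  trace at both ends**: `c = g(t₀)` for every continuous representative `g` of `t ↦ ∫⟪u(t), φ⟫` on
  `[0,T]` and `c = h(t₀)` for every continuous representative `h` of `r ↦ ∫⟪ψ(r), u₀⟫` on `[0,t₀]`
  (representatives exist by `PassiveVectorTensorWeakContinuity.exists_continuousOn_integral_inner`):
  "`⟨u(t₀), φ⟩ = ⟨u₀, ψ(t₀)⟩`", using the strong `L²` initial traces of `ψ` and `u`.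
* `Torus.memLp_top_stLift_reversed` — the reversed carrier `r ↦ −b(t₀ − r)` is essentially bounded on
  `(0,t₀) × T^d` when `b` is on `(0,T) × T^d` (so the adjoint problem has a weak solution by
  `PassiveVectorTensorLionsExistence.exists_isWeakTensorPassiveVectorOn`, with
  `nearIso_majorTranspose_iff`);
* `Torus.inner_symbT_majorTranspose_left` (`⟪T_{𝔸ᵀ}(k)X, Y⟫ = ⟪X, T_𝔸(k)Y⟫`),
  `Torus.integral_inner_convect_fourierTruncate_eq_sum` (transport pairing against a truncation in
  Fourier variables), `Torus.integral_inner_convect_add_swap_eq_zero` (antisymmetry of the trilinear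
  form for a weakly divergence-free carrier), `Torus.integral_inner_convect_fourierTruncate_add_swap`
  (the cross flux is a remainder, with its bound), `Torus.abs_le_of_ae_abs_le_of_continuousOn`
  (an a.e. bound on a pairing holds for its continuous representative at every time).

Cell `ad-ideate`, K1L `stub_cellEnergyT` clause (F) uniform in `T` by duality (planner finding
F-p4g10-1, lemma D1 `PairingConst`; D2/D3 are `PassiveVectorTensorWeakContinuity`): with `φ` a slow
single mode and `u₀ = F` the forcing profile, `|g_φ(t₀)| = |h_F(t₀)| ≤ sup_r |∫⟪ψ(r), F⟫|`, which the
adjoint problem's fast-content bound controls uniformly in `t₀`.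

## Mathlib / tree search

Tree: `PassiveVectorTensorFourier` (`ae_inner_mFourierCoeff_eq`, `integrableOn_modeRHS`, `symbT`),
`PassiveVectorTensorUniqueness` (`mem_orthogonal_waveVec_iff`, `ae_sum_mul_mFourierCoeff_eq_zero`),
`PassiveVectorTensorGalerkinTail` (`galerkin_tail`, `integrableOn_toReal_eGradNormSq_fourierTruncate`),
`PassiveVectorTensorEnergyDecay` (pattern of the remainder estimate),
`PassiveVectorGalerkinIdentity` (`sum_mul_integral_inner_convect_eq`,
`abs_integral_inner_convect_le_of_norm_le`, `gradNormSq_fourierTruncate`), `PassiveVectorFourier`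
(`integral_inner_convect_realTrigPoly_singleton`), `NSUniqueness2DProofs`
(`integral_inner_self_convect_eq_zero_of_isWeaklyDivFree`), `DuBoisReymondAE`
(`mul_eq_add_setIntegral_of_eq_add_setIntegral`, real; the complex twin is proved here),
`TorusVectorParseval` (`hasSum_re_inner_mFourierCoeff_complexify`), `PassiveScalarEnergyProofs`
(`ae_ae_norm_le_of_memLp_top_stLift`). Mathlib: `Measure.measurePreserving_sub_left`,
`MeasurableEquiv.subLeft`, `MeasurePreserving.integrableOn_comp_preimage`,
`MeasurePreserving.setIntegral_preimage_emb`, `intervalIntegral.integral_comp_sub_left`,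
`integral_conj`, `OrthonormalBasis.sum_repr'`.

## References

* R. Temam, *Navier–Stokes Equations*, 3rd ed. (North-Holland 1984), Ch. III §1, Lemma 1.2
  (`u ∈ L²(V)`, `u' ∈ L²(V')` ⇒ `d/dt|u|² = 2⟨u', u⟩`; polarised for two functions) and Lemma 1.4.
  [`Temam1984`]
* U. Frisch, *Turbulence* (CUP 1995), §9.6.3 eq. (9.57) p. 233 (anisotropic eddy viscosity).
  [`Frisch1995Turbulence`]
* J. E. Avron, *Odd viscosity*, J. Stat. Phys. 92 (1998), §2 (1)–(2) (major transpose).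
  [`Avron1998OddViscosity`]
* J. C. Robinson, J. L. Rodrigo, W. Sadowski, *The three-dimensional Navier–Stokes equations*
  (CUP 2016), §4.1–§4.2, (4.20). [`RobinsonRodrigoSadowski2016`]
* S. Kuksin, A. Shirikyan, *Mathematics of two-dimensional turbulence* (CUP 2012), Prop. 2.1.7,
  (2.11)–(2.12). [`KuksinShirikyan2012`]
-/

noncomputable section

open MeasureTheory Set Filter Function TopologicalSpace Complex UnitAddTorus
open scoped ENNReal NNReal InnerProductSpace Topology ComplexConjugate

namespace Literature.Analysis.FluidPDE

namespace Torus

variable {d : Type*} [Fintype d] [DecidableEq d]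

/-! ## Scalar lemmas: products of complex primitives, time reversal -/

section Scalar

omit [Fintype d] [DecidableEq d] in
/-- **Fubini on a triangle, complex-valued.** For `f, g : ℝ → ℂ` integrable on `(a, b]`,
`∫_{(a,b]} f(s) (∫_{(a,s]} g) ds + ∫_{(a,b]} g(r) (∫_{(a,r]} f) dr = (∫_{(a,b]} f) (∫_{(a,b]} g)`
(the real statement is `FunctionSpaces.setIntegral_mul_setIntegral_add_symm`). [folklore] -/
private theorem setIntegral_mul_setIntegral_add_symm_complex {a b : ℝ} {f g : ℝ → ℂ}
    (hf : IntegrableOn f (Ioc a b)) (hg : IntegrableOn g (Ioc a b)) :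
    (∫ s in Ioc a b, f s * ∫ r in Ioc a s, g r) + (∫ r in Ioc a b, g r * ∫ s in Ioc a r, f s) =
      (∫ s in Ioc a b, f s) * ∫ r in Ioc a b, g r := by
  set μ : Measure ℝ := volume.restrict (Ioc a b) with hμ
  have hprod : Integrable (fun z : ℝ × ℝ => f z.1 * g z.2) (μ.prod μ) := hf.mul_prod hg
  have hS : MeasurableSet {z : ℝ × ℝ | z.2 ≤ z.1} := measurableSet_le measurable_snd measurable_fst
  rw [← integral_prod_mul (μ := μ) (ν := μ) f g,
    ← indicator_self_add_compl {z : ℝ × ℝ | z.2 ≤ z.1} (fun z : ℝ × ℝ => f z.1 * g z.2),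
    integral_add' (hprod.indicator hS) (hprod.indicator hS.compl)]
  congr 1
  · rw [integral_prod _ (hprod.indicator hS)]
    refine integral_congr_ae ?_
    filter_upwards [ae_restrict_mem measurableSet_Ioc] with s hs
    have h1 : (fun r => {z : ℝ × ℝ | z.2 ≤ z.1}.indicator (fun z : ℝ × ℝ => f z.1 * g z.2) (s, r)) =
        fun r => f s * (Iic s).indicator g r := by
      funext r
      by_cases hr : r ≤ s
      · rw [indicator_of_mem (show (s, r) ∈ {z : ℝ × ℝ | z.2 ≤ z.1} from hr),
          indicator_of_mem (show r ∈ Iic s from hr)]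
      · rw [indicator_of_notMem (show (s, r) ∉ {z : ℝ × ℝ | z.2 ≤ z.1} from hr),
          indicator_of_notMem (show r ∉ Iic s from hr), mul_zero]
    have hset : Ioc a b ∩ Iic s = Ioc a s := by
      ext r
      simp only [mem_inter_iff, mem_Ioc, mem_Iic]
      constructor
      · rintro ⟨⟨h1, -⟩, h3⟩
        exact ⟨h1, h3⟩
      · rintro ⟨h1, h2⟩
        exact ⟨⟨h1, h2.trans hs.2⟩, h2⟩
    rw [h1, MeasureTheory.integral_const_mul, hμ, setIntegral_indicator measurableSet_Iic, hset]
  · rw [integral_prod_symm _ (hprod.indicator hS.compl)]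
    refine integral_congr_ae ?_
    filter_upwards [ae_restrict_mem measurableSet_Ioc] with r hr
    have h1 : (fun s => {z : ℝ × ℝ | z.2 ≤ z.1}ᶜ.indicator (fun z : ℝ × ℝ => f z.1 * g z.2) (s, r)) =
        fun s => g r * (Iio r).indicator f s := by
      funext s
      by_cases hs : s < r
      · rw [indicator_of_mem (show (s, r) ∈ {z : ℝ × ℝ | z.2 ≤ z.1}ᶜ from not_le.2 hs),
          indicator_of_mem (show s ∈ Iio r from hs), mul_comm]
      · rw [indicator_of_notMem (show (s, r) ∉ {z : ℝ × ℝ | z.2 ≤ z.1}ᶜ from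
            fun h => h (not_lt.1 hs)),
          indicator_of_notMem (show s ∉ Iio r from hs), mul_zero]
    have hset : Ioc a b ∩ Iio r = Ioo a r := by
      ext s
      simp only [mem_inter_iff, mem_Ioc, mem_Iio, mem_Ioo]
      constructor
      · rintro ⟨⟨h1, -⟩, h3⟩
        exact ⟨h1, h3⟩
      · rintro ⟨h1, h2⟩
        exact ⟨⟨h1, h2.le.trans hr.2⟩, h2⟩
    rw [h1, MeasureTheory.integral_const_mul, hμ, setIntegral_indicator measurableSet_Iio, hset,
      integral_Ioc_eq_integral_Ioo]

omit [Fintype d] [DecidableEq d] in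
/-- **Product formula for complex primitives** (integration by parts for absolutely continuous
functions, in integral form): if `F(t) = α + ∫_{(0,t]} φ` and `G(t) = β + ∫_{(0,t]} γ` on `(0, T]`
with `φ, γ ∈ L¹(0,T; ℂ)`, then `s ↦ φ(s)G(s) + F(s)γ(s)` is integrable on `(0,t]` and
`F(t)G(t) = αβ + ∫_{(0,t]} (φ G + F γ)` for every `t ∈ (0, T]` (the real statement is
`FunctionSpaces.mul_eq_add_setIntegral_of_eq_add_setIntegral`). [folklore] -/
private theorem mul_eq_add_setIntegral_of_eq_add_setIntegral_complex {T : ℝ} {F G φ γ : ℝ → ℂ} {α β : ℂ}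
    (hφ : IntegrableOn φ (Ioo 0 T)) (hγ : IntegrableOn γ (Ioo 0 T))
    (hF : ∀ t ∈ Ioc 0 T, F t = α + ∫ s in Ioc 0 t, φ s)
    (hG : ∀ t ∈ Ioc 0 T, G t = β + ∫ s in Ioc 0 t, γ s) {t : ℝ} (ht : t ∈ Ioc 0 T) :
    IntegrableOn (fun s => φ s * G s + F s * γ s) (Ioc 0 t) ∧
      F t * G t = α * β + ∫ s in Ioc 0 t, (φ s * G s + F s * γ s) := by
  have hsub : Ioc 0 t ⊆ Ioc 0 T := Ioc_subset_Ioc_right ht.2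
  have hφT : IntegrableOn φ (Ioc 0 T) := (integrableOn_Ioc_iff_integrableOn_Ioo (f := φ)).2 hφ
  have hγT : IntegrableOn γ (Ioc 0 T) := (integrableOn_Ioc_iff_integrableOn_Ioo (f := γ)).2 hγ
  have hφt : IntegrableOn φ (Ioc 0 t) := hφT.mono_set hsub
  have hγt : IntegrableOn γ (Ioc 0 t) := hγT.mono_set hsub
  set Φ : ℝ → ℂ := fun s => ∫ r in Ioc 0 s, φ r with hΦ
  set Γ : ℝ → ℂ := fun s => ∫ r in Ioc 0 s, γ r with hΓ
  have hΦc : ContinuousOn Φ (Icc 0 t) :=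
    intervalIntegral.continuousOn_primitive ((integrableOn_Icc_iff_integrableOn_Ioc (f := φ)).2 hφt)
  have hΓc : ContinuousOn Γ (Icc 0 t) :=
    intervalIntegral.continuousOn_primitive ((integrableOn_Icc_iff_integrableOn_Ioc (f := γ)).2 hγt)
  obtain ⟨CΦ, hCΦ⟩ := isCompact_Icc.exists_bound_of_continuousOn hΦc
  obtain ⟨CΓ, hCΓ⟩ := isCompact_Icc.exists_bound_of_continuousOn hΓc
  have hΦm : AEStronglyMeasurable Φ (volume.restrict (Ioc 0 t)) :=
    (hΦc.mono Ioc_subset_Icc_self).aestronglyMeasurable measurableSet_Ioc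
  have hΓm : AEStronglyMeasurable Γ (volume.restrict (Ioc 0 t)) :=
    (hΓc.mono Ioc_subset_Icc_self).aestronglyMeasurable measurableSet_Ioc
  have hΦb : ∀ᵐ s ∂(volume.restrict (Ioc 0 t)), ‖Φ s‖ ≤ CΦ :=
    (ae_restrict_mem measurableSet_Ioc).mono fun s hs => hCΦ s (Ioc_subset_Icc_self hs)
  have hΓb : ∀ᵐ s ∂(volume.restrict (Ioc 0 t)), ‖Γ s‖ ≤ CΓ :=
    (ae_restrict_mem measurableSet_Ioc).mono fun s hs => hCΓ s (Ioc_subset_Icc_self hs)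
  have i1 : IntegrableOn (fun s => φ s * Γ s) (Ioc 0 t) := by
    have h := hφt.bdd_mul hΓm hΓb
    exact h.congr (ae_of_all _ fun s => mul_comm _ _)
  have i2 : IntegrableOn (fun s => γ s * Φ s) (Ioc 0 t) := by
    have h := hγt.bdd_mul hΦm hΦb
    exact h.congr (ae_of_all _ fun s => mul_comm _ _)
  have hG' : ∀ᵐ s ∂(volume.restrict (Ioc 0 t)), φ s * G s = β * φ s + φ s * Γ s :=
    (ae_restrict_mem measurableSet_Ioc).mono fun s hs => by rw [hG s (hsub hs)]; ring
  have hF' : ∀ᵐ s ∂(volume.restrict (Ioc 0 t)), F s * γ s = α * γ s + γ s * Φ s :=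
    (ae_restrict_mem measurableSet_Ioc).mono fun s hs => by rw [hF s (hsub hs)]; ring
  have j1 : IntegrableOn (fun s => φ s * G s) (Ioc 0 t) :=
    ((hφt.const_mul β).add i1).congr (hG'.mono fun s hs => hs.symm)
  have j2 : IntegrableOn (fun s => F s * γ s) (Ioc 0 t) :=
    ((hγt.const_mul α).add i2).congr (hF'.mono fun s hs => hs.symm)
  refine ⟨j1.add j2, ?_⟩
  rw [integral_add j1 j2, integral_congr_ae hG', integral_congr_ae hF',
    integral_add (hφt.const_mul β) i1, integral_add (hγt.const_mul α) i2, MeasureTheory.integral_const_mul,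
    MeasureTheory.integral_const_mul, hF t ht, hG t ht]
  have key := setIntegral_mul_setIntegral_add_symm_complex hφt hγt
  calc (α + Φ t) * (β + Γ t) = α * β + (β * Φ t + α * Γ t + Φ t * Γ t) := by ring
    _ = α * β + (β * Φ t + (∫ s in Ioc 0 t, φ s * Γ s) + (α * Γ t + ∫ s in Ioc 0 t, γ s * Φ s)) := by
        rw [hΦ, hΓ]
        dsimp only
        rw [← key]
        ring

omit [Fintype d] [DecidableEq d] in
/-- Time reversal `s ↦ t₀ - s` is measure preserving on Lebesgue measure. [folklore] -/
private theorem measurePreserving_sub_left₁₀ (t₀ : ℝ) :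
    MeasurePreserving (fun s : ℝ => t₀ - s) volume volume :=
  Measure.measurePreserving_sub_left volume t₀

omit [Fintype d] [DecidableEq d] in
/-- Time reversal is a measurable embedding. [folklore] -/
private theorem measurableEmbedding_sub_left₁₀ (t₀ : ℝ) :
    MeasurableEmbedding (fun s : ℝ => t₀ - s) :=
  (MeasurableEquiv.subLeft t₀).measurableEmbedding

omit [Fintype d] [DecidableEq d] in
/-- Time reversal maps `(0,t₀)` onto itself. [folklore] -/
private theorem preimage_sub_left_Ioo (t₀ : ℝ) : (fun s : ℝ => t₀ - s) ⁻¹' Ioo 0 t₀ = Ioo 0 t₀ := by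
  ext s
  simp only [mem_preimage, mem_Ioo]
  constructor <;> rintro ⟨h1, h2⟩ <;> constructor <;> linarith

omit [Fintype d] [DecidableEq d] in
/-- **Time reversal of a.e. statements on `(0,t₀)`**: if `P r` holds for a.e. `r ∈ (0,t₀)` then
`P (t₀ - s)` holds for a.e. `s ∈ (0,t₀)`. [folklore] -/
private theorem ae_restrict_Ioo_comp_sub_left {t₀ : ℝ} {P : ℝ → Prop}
    (h : ∀ᵐ r ∂(volume.restrict (Ioo 0 t₀)), P r) :
    ∀ᵐ s ∂(volume.restrict (Ioo 0 t₀)), P (t₀ - s) := by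
  have h' : ∀ᵐ r ∂(volume : Measure ℝ), r ∈ Ioo 0 t₀ → P r := (ae_restrict_iff' measurableSet_Ioo).1 h
  have h'' := (measurePreserving_sub_left₁₀ t₀).quasiMeasurePreserving.ae h'
  refine (ae_restrict_iff' measurableSet_Ioo).2 (h''.mono fun s hs hsI => hs ?_)
  have : s ∈ (fun s : ℝ => t₀ - s) ⁻¹' Ioo 0 t₀ := by rw [preimage_sub_left_Ioo]; exact hsI
  exact this

omit [Fintype d] [DecidableEq d] in
/-- Time reversal of integrability on `(0,t₀)`. [folklore] -/
private theorem integrableOn_comp_sub_left {E : Type*} [NormedAddCommGroup E] {t₀ : ℝ} {f : ℝ → E}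
    (hf : IntegrableOn f (Ioo 0 t₀)) : IntegrableOn (fun s => f (t₀ - s)) (Ioo 0 t₀) := by
  have h := ((measurePreserving_sub_left₁₀ t₀).integrableOn_comp_preimage
    (measurableEmbedding_sub_left₁₀ t₀) (f := f) (s := Ioo 0 t₀)).2 hf
  rw [preimage_sub_left_Ioo] at h
  exact h

omit [Fintype d] [DecidableEq d] in
/-- Time reversal of set integrals over `(0,t₀)`: `∫_{(0,t₀)} f(t₀ - s) ds = ∫_{(0,t₀)} f`. [folklore] -/
private theorem setIntegral_Ioo_comp_sub_left {E : Type*} [NormedAddCommGroup E] [NormedSpace ℝ E]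
    {t₀ : ℝ} (f : ℝ → E) : ∫ s in Ioo 0 t₀, f (t₀ - s) = ∫ r in Ioo 0 t₀, f r := by
  have h := (measurePreserving_sub_left₁₀ t₀).setIntegral_preimage_emb (measurableEmbedding_sub_left₁₀ t₀) f (Ioo 0 t₀)
  rwa [preimage_sub_left_Ioo] at h

omit [Fintype d] [DecidableEq d] in
/-- **The reversed primitive.** For `γ ∈ L¹(0,t₀)` and `s ∈ [0,t₀]`:
`∫_{(0,t₀-s]} γ = ∫_{(0,t₀]} γ + ∫_{(0,s]} (−γ(t₀ − σ)) dσ`. [folklore] -/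
private theorem setIntegral_Ioc_sub_eq {E : Type*} [NormedAddCommGroup E] [NormedSpace ℝ E] [CompleteSpace E]
    {t₀ : ℝ} {γ : ℝ → E} (hγ : IntegrableOn γ (Ioo 0 t₀)) {s : ℝ} (hs : s ∈ Icc 0 t₀) :
    ∫ σ in Ioc 0 (t₀ - s), γ σ = (∫ σ in Ioc 0 t₀, γ σ) + ∫ σ in Ioc 0 s, -γ (t₀ - σ) := by
  have hγI : IntegrableOn γ (Icc 0 t₀) := (integrableOn_Icc_iff_integrableOn_Ioo (f := γ)).2 hγ
  have hi : ∀ {a c : ℝ}, 0 ≤ a → a ≤ c → c ≤ t₀ → IntervalIntegrable γ volume a c := by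
    intro a c ha hac hc
    refine (hγI.mono_set ?_).intervalIntegrable
    rw [uIcc_of_le hac]
    exact Icc_subset_Icc ha hc
  have h1 : 0 ≤ t₀ - s := by linarith [hs.2]
  have h2 : t₀ - s ≤ t₀ := by linarith [hs.1]
  rw [← intervalIntegral.integral_of_le h1, ← intervalIntegral.integral_of_le (hs.1.trans hs.2),
    ← intervalIntegral.integral_of_le hs.1, intervalIntegral.integral_neg,
    intervalIntegral.integral_comp_sub_left (fun σ => γ σ) t₀, sub_zero,
    ← intervalIntegral.integral_add_adjacent_intervals (hi le_rfl h1 h2) (hi h1 h2 le_rfl)]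
  abel

end Scalar

/-! ## The symbol matrix of the transposed tensor is the adjoint -/

section Symbol

omit [DecidableEq d]

/-- **The symbol matrix of the major transpose is the adjoint**: for every integer wave vector `k`
and `X, Y ∈ ℂ^d`, `⟪T_{𝔸ᵀ}(k) X, Y⟫ = ⟪X, T_𝔸(k) Y⟫` (`(T_𝔸(k))_{ji} = Σ_{a,b} 𝔸 i a j b k_a k_b` is a
real matrix and `(T_{𝔸ᵀ}(k))_{ij} = Σ_{a,b} 𝔸 j b i a k_a k_b = (T_𝔸(k))_{ji}`): the viscous operator of
the transposed tensor is the `L²`-adjoint, mode by mode (`viscAdj_eq_viscOp_majorTranspose` in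
physical space). [cite: Avron1998OddViscosity, §2 eq. (1)-(2)] -/
theorem inner_symbT_majorTranspose_left (𝔸 : Visc4 d) (k : d → ℤ) (X Y : EuclideanSpace ℂ d) :
    ⟪symbT (majorTranspose 𝔸) k X, Y⟫_ℂ = ⟪X, symbT 𝔸 k Y⟫_ℂ := by
  -- both sides equal the same quadruple sum
  have hL : ⟪symbT (majorTranspose 𝔸) k X, Y⟫_ℂ =
      ∑ j, ∑ i, ∑ a, ∑ b, ((𝔸 j b i a * (k a : ℝ) * (k b : ℝ) : ℝ) : ℂ) * (conj (X i) * Y j) := by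
    rw [PiLp.inner_apply]
    refine Finset.sum_congr rfl fun j _ => ?_
    rw [RCLike.inner_apply, symbT_apply]
    simp only [majorTranspose_apply, map_sum, map_mul, Complex.conj_ofReal, Finset.mul_sum]
    refine Finset.sum_congr rfl fun i _ => Finset.sum_congr rfl fun a _ => Finset.sum_congr rfl fun b _ => ?_
    ring
  have hR : ⟪X, symbT 𝔸 k Y⟫_ℂ =
      ∑ i, ∑ j, ∑ a, ∑ b, ((𝔸 j a i b * (k a : ℝ) * (k b : ℝ) : ℝ) : ℂ) * (conj (X i) * Y j) := by
    rw [PiLp.inner_apply]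
    refine Finset.sum_congr rfl fun i _ => ?_
    rw [RCLike.inner_apply, symbT_apply]
    simp only [Finset.sum_mul]
    refine Finset.sum_congr rfl fun j _ => Finset.sum_congr rfl fun a _ => Finset.sum_congr rfl fun b _ => ?_
    ring
  rw [hL, hR, Finset.sum_comm]
  refine Finset.sum_congr rfl fun i _ => Finset.sum_congr rfl fun j _ => ?_
  rw [Finset.sum_comm]
  refine Finset.sum_congr rfl fun b _ => Finset.sum_congr rfl fun a _ => ?_
  push_cast
  ring

end Symbol

/-! ## Orthonormal-basis algebra in the transversal subspace -/

section Onb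

omit [DecidableEq d]

/-- Pulling a scalar out of a transport sum. [folklore] -/
private theorem modeRHS_sumpull₁₀ (k : d → ℤ) (μ : ℂ) (f : d → ℂ) :
    ∑ j, (2 * Real.pi * I * (k j)) * (μ * f j) = μ * ∑ j, (2 * Real.pi * I * (k j)) * f j := by
  rw [Finset.mul_sum]; exact Finset.sum_congr rfl fun j _ => by ring

/-- The mode right-hand side `H(z) = −4π² ⟪X, T_𝔸(k) z⟫ + B(z)` is `ℂ`-linear in `z`:
`H(Σᵢ μᵢ eᵢ) = Σᵢ μᵢ H(eᵢ)`. [folklore] -/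
private theorem modeRHS_sum_smul₁₀ {ι : Type*} (s : Finset ι) (𝔸 : Visc4 d) (k : d → ℤ) (A : ℝ)
    (X : EuclideanSpace ℂ d) (F G : d → EuclideanSpace ℂ d) (μ : ι → ℂ) (e : ι → EuclideanSpace ℂ d) :
    (-(4 * Real.pi ^ 2 : ℝ) : ℂ) * ⟪X, symbT 𝔸 k (∑ i ∈ s, μ i • e i)⟫_ℂ +
        ((∑ j, (2 * Real.pi * I * (k j)) * ⟪F j, ∑ i ∈ s, μ i • e i⟫_ℂ) +
          (A : ℂ) * ∑ j, (2 * Real.pi * I * (k j)) * ⟪G j, ∑ i ∈ s, μ i • e i⟫_ℂ) =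
      ∑ i ∈ s, μ i * ((-(4 * Real.pi ^ 2 : ℝ) : ℂ) * ⟪X, symbT 𝔸 k (e i)⟫_ℂ +
        ((∑ j, (2 * Real.pi * I * (k j)) * ⟪F j, e i⟫_ℂ) + (A : ℂ) * ∑ j, (2 * Real.pi * I * (k j)) * ⟪G j, e i⟫_ℂ)) := by
  classical
  induction s using Finset.induction_on with
  | empty => simp
  | insert a s ha ih =>
    rw [Finset.sum_insert ha, Finset.sum_insert ha, ← ih]
    simp only [symbT_add, symbT_smul, inner_add_right, inner_smul_right, mul_add, Finset.sum_add_distrib,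
      modeRHS_sumpull₁₀]
    ring

/-- Expansion in a subspace with conjugated coefficients: `Σᵢ conj⟪X, eᵢ⟫ eᵢ = X` for `X ∈ S`.
[folklore] -/
private theorem sum_conj_inner_smul_onb₁₀ {ι : Type*} [Fintype ι] {S : Submodule ℂ (EuclideanSpace ℂ d)}
    (b : OrthonormalBasis ι ℂ S) {X : EuclideanSpace ℂ d} (hX : X ∈ S) :
    ∑ i, conj ⟪X, (b i : EuclideanSpace ℂ d)⟫_ℂ • (b i : EuclideanSpace ℂ d) = X := by
  have h := b.sum_repr' ⟨X, hX⟩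
  have h' := congrArg (fun v : S => (v : EuclideanSpace ℂ d)) h
  simp only [Submodule.coe_sum, Submodule.coe_smul, Submodule.coe_inner] at h'
  simp_rw [inner_conj_symm]
  exact h'

/-- The pairing through an orthonormal basis of a subspace containing the second vector:
`Σᵢ ⟪X, eᵢ⟫ conj⟪Y, eᵢ⟫ = ⟪X, Y⟫` for `Y ∈ S` and every `X`. [folklore] -/
private theorem sum_inner_mul_conj_inner_onb₁₀ {ι : Type*} [Fintype ι] {S : Submodule ℂ (EuclideanSpace ℂ d)}
    (b : OrthonormalBasis ι ℂ S) (X : EuclideanSpace ℂ d) {Y : EuclideanSpace ℂ d} (hY : Y ∈ S) :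
    ∑ i, ⟪X, (b i : EuclideanSpace ℂ d)⟫_ℂ * conj ⟪Y, (b i : EuclideanSpace ℂ d)⟫_ℂ = ⟪X, Y⟫_ℂ := by
  conv_rhs => rw [← sum_conj_inner_smul_onb₁₀ b hY]
  rw [inner_sum]
  refine Finset.sum_congr rfl fun i _ => ?_
  rw [inner_smul_right, mul_comm]

end Onb

/-! ## The transport pairing against a truncation, in Fourier variables; antisymmetry -/

section Flux

/-- `P_N u = ∑_{|k|≤N} Re (e_k • û(k))` as a sum of single real modes. [folklore] -/
private theorem fourierTruncate_eq_sum_singleton₁₀ (N : ℕ) (u : UnitAddTorus d → EuclideanSpace ℝ d) :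
    FunctionSpaces.Torus.fourierTruncate N u = fun y => ∑ k ∈ FunctionSpaces.Torus.freqBall N,
      (1 : ℝ) • FunctionSpaces.Torus.realTrigPoly {k}
        (fun k' => mFourierCoeff (FunctionSpaces.EuclideanSpace.complexify ∘ u) k') y := by
  funext y
  rw [FunctionSpaces.Torus.fourierTruncate_eq, FunctionSpaces.Torus.realTrigPoly_apply_eq_sum]
  refine Finset.sum_congr rfl fun k _ => ?_
  rw [one_smul, FunctionSpaces.Torus.realTrigPoly_apply_eq_sum, Finset.sum_singleton]

/-- **The transport pairing against a truncation in Fourier variables**: if the products `cⱼ v`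
are integrable then, for every field `w` and every `N`,
`∫⟪v, (c·∇)P_N w⟫ = ∑_{|k|≤N} Re ∑ⱼ 2πikⱼ ⟪𝓕(cⱼ v)(k), ŵ(k)⟫` (linearity of the trilinear form in the
test field and the single-mode pairings). [cite: RobinsonRodrigoSadowski2016, §4.1 (Galerkin truncations)] -/
theorem integral_inner_convect_fourierTruncate_eq_sum {c v : UnitAddTorus d → EuclideanSpace ℝ d}
    (hcv : ∀ j, Integrable (fun x => c x j • v x) volume) (w : UnitAddTorus d → EuclideanSpace ℝ d) (N : ℕ) :
    ∫ x, ⟪v x, FunctionSpaces.Torus.convect c (FunctionSpaces.Torus.fourierTruncate N w) x⟫_ℝ =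
      ∑ k ∈ FunctionSpaces.Torus.freqBall N, (∑ j, (2 * Real.pi * I * (k j)) *
        ⟪mFourierCoeff (FunctionSpaces.EuclideanSpace.complexify ∘ fun x => c x j • v x) k,
          mFourierCoeff (FunctionSpaces.EuclideanSpace.complexify ∘ w) k⟫_ℂ).re := by
  set cf : (d → ℤ) → EuclideanSpace ℂ d := fun k' => mFourierCoeff (FunctionSpaces.EuclideanSpace.complexify ∘ w) k'
    with hcf
  have ha : ∀ k : d → ℤ, FunctionSpaces.Torus.IsSmooth (FunctionSpaces.Torus.realTrigPoly {k} cf) :=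
    fun k => FunctionSpaces.Torus.isSmooth_realTrigPoly _ _
  rw [fourierTruncate_eq_sum_singleton₁₀ N w,
    ← sum_mul_integral_inner_convect_eq (FunctionSpaces.Torus.freqBall N) (fun _ => (1 : ℝ)) ha hcv]
  refine Finset.sum_congr rfl fun k _ => ?_
  rw [one_mul, integral_inner_convect_realTrigPoly_singleton hcv k cf]

omit [DecidableEq d] in
/-- Products of an integrable carrier with a continuous field are integrable. [folklore] -/
private theorem integrable_smul_of_continuous₁₀ {c Φ : UnitAddTorus d → EuclideanSpace ℝ d}
    (hc : Integrable c volume) (hΦ : Continuous Φ) (j : d) :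
    Integrable (fun x => c x j • Φ x) volume := by
  obtain ⟨C, hC⟩ := (isCompact_univ.image hΦ).isBounded.exists_norm_le
  have hC' : ∀ x, ‖Φ x‖ ≤ C := fun x => hC _ ⟨x, mem_univ _, rfl⟩
  refine Integrable.mono' (hc.norm.mul_const C)
    (((EuclideanSpace.proj j).continuous.comp_aestronglyMeasurable hc.1).smul hΦ.aestronglyMeasurable)
    (ae_of_all _ fun x => ?_)
  rw [norm_smul]
  exact mul_le_mul (by simpa [Real.norm_eq_abs] using FunctionSpaces.Torus.abs_apply_le_norm (c x) j) (hC' x)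
    (norm_nonneg _) (norm_nonneg _)

omit [DecidableEq d] in
/-- `(u·∇)(f + g) = (u·∇)f + (u·∇)g` pointwise for `C¹` fields. [folklore] -/
private theorem convect_add₁₀ (u : UnitAddTorus d → EuclideanSpace ℝ d) {f g : UnitAddTorus d → EuclideanSpace ℝ d}
    (hf : FunctionSpaces.Torus.IsContDiff 1 f) (hg : FunctionSpaces.Torus.IsContDiff 1 g) (x : UnitAddTorus d) :
    FunctionSpaces.Torus.convect u (f + g) x = FunctionSpaces.Torus.convect u f x + FunctionSpaces.Torus.convect u g x := by
  simp only [FunctionSpaces.Torus.convect, FunctionSpaces.Torus.fderiv_add hf hg x]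
  rfl

/-- **Antisymmetry of the trilinear form in its two field arguments, weak form**: for an
integrable weakly divergence-free `c` and smooth `Φ, Ψ`, `∫⟪Φ, (c·∇)Ψ⟫ + ∫⟪Ψ, (c·∇)Φ⟫ = 0`
(polarise `∫⟪Φ, (c·∇)Φ⟫ = 0`; Kuksin–Shirikyan 2012, (2.11)–(2.12): `b(u,v,w) = −b(u,w,v)`).
[cite: KuksinShirikyan2012, Prop. 2.1.7 (2.11)] -/
theorem integral_inner_convect_add_swap_eq_zero {c Φ Ψ : UnitAddTorus d → EuclideanSpace ℝ d}
    (hc : Integrable c volume) (hcdiv : FunctionSpaces.Torus.IsWeaklyDivFree c)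
    (hΦ : FunctionSpaces.Torus.IsSmooth Φ) (hΨ : FunctionSpaces.Torus.IsSmooth Ψ) :
    (∫ x, ⟪Φ x, FunctionSpaces.Torus.convect c Ψ x⟫_ℝ) + ∫ x, ⟪Ψ x, FunctionSpaces.Torus.convect c Φ x⟫_ℝ = 0 := by
  have hΦ1 : FunctionSpaces.Torus.IsContDiff 1 Φ := hΦ.isContDiff (by simp)
  have hΨ1 : FunctionSpaces.Torus.IsContDiff 1 Ψ := hΨ.isContDiff (by simp)
  have hcΦ : ∀ j, Integrable (fun x => c x j • Φ x) volume := integrable_smul_of_continuous₁₀ hc hΦ.continuous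
  have hcΨ : ∀ j, Integrable (fun x => c x j • Ψ x) volume := integrable_smul_of_continuous₁₀ hc hΨ.continuous
  have iΦΦ := integrable_inner_convect_of_integrable_smul hcΦ hΦ
  have iΦΨ := integrable_inner_convect_of_integrable_smul hcΦ hΨ
  have iΨΦ := integrable_inner_convect_of_integrable_smul hcΨ hΦ
  have iΨΨ := integrable_inner_convect_of_integrable_smul hcΨ hΨ
  have h0 := integral_inner_self_convect_eq_zero_of_isWeaklyDivFree hcdiv (hΦ.add hΨ)
  have hΦ0 := integral_inner_self_convect_eq_zero_of_isWeaklyDivFree hcdiv hΦ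
  have hΨ0 := integral_inner_self_convect_eq_zero_of_isWeaklyDivFree hcdiv hΨ
  have hpt : ∀ x, ⟪(Φ + Ψ) x, FunctionSpaces.Torus.convect c (Φ + Ψ) x⟫_ℝ =
      (⟪Φ x, FunctionSpaces.Torus.convect c Φ x⟫_ℝ + ⟪Φ x, FunctionSpaces.Torus.convect c Ψ x⟫_ℝ) +
        (⟪Ψ x, FunctionSpaces.Torus.convect c Φ x⟫_ℝ + ⟪Ψ x, FunctionSpaces.Torus.convect c Ψ x⟫_ℝ) := by
    intro x
    rw [convect_add₁₀ c hΦ1 hΨ1 x, Pi.add_apply, inner_add_left, inner_add_right, inner_add_right]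
  simp_rw [hpt] at h0
  have iA : Integrable (fun x => ⟪Φ x, FunctionSpaces.Torus.convect c Φ x⟫_ℝ +
      ⟪Φ x, FunctionSpaces.Torus.convect c Ψ x⟫_ℝ) volume := iΦΦ.add iΦΨ
  have iB : Integrable (fun x => ⟪Ψ x, FunctionSpaces.Torus.convect c Φ x⟫_ℝ +
      ⟪Ψ x, FunctionSpaces.Torus.convect c Ψ x⟫_ℝ) volume := iΨΦ.add iΨΨ
  rw [integral_add iA iB, integral_add iΦΦ iΦΨ, integral_add iΨΦ iΨΨ, hΦ0, hΨ0] at h0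
  linarith

/-- **The cross transport flux against the truncations is a remainder.** For `u, v ∈ L²`, an
integrable weakly divergence-free carrier `c` with `‖c‖ ≤ M` a.e. and integrable products
`cⱼ u`, `cⱼ v`:
`∫⟪u,(c·∇)P_N v⟫ + ∫⟪v,(c·∇)P_N u⟫ = ∫⟪u − P_N u,(c·∇)P_N v⟫ + ∫⟪v − P_N v,(c·∇)P_N u⟫`, of absolute
value `≤ d M ((∫‖u − P_N u‖²)^{1/2} ‖∇P_N v‖₂ + (∫‖v − P_N v‖²)^{1/2} ‖∇P_N u‖₂)`
(antisymmetry on the truncations, Cauchy–Schwarz). [cite: RobinsonRodrigoSadowski2016, §4.2 (4.20)] -/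
theorem integral_inner_convect_fourierTruncate_add_swap {c u v : UnitAddTorus d → EuclideanSpace ℝ d}
    (hc : Integrable c volume) (hcdiv : FunctionSpaces.Torus.IsWeaklyDivFree c) {M : ℝ} (hM : 0 ≤ M)
    (hcM : ∀ᵐ x ∂volume, ‖c x‖ ≤ M) (hu : MemLp u 2 volume) (hv : MemLp v 2 volume)
    (hcu : ∀ j, Integrable (fun x => c x j • u x) volume) (hcv' : ∀ j, Integrable (fun x => c x j • v x) volume)
    (N : ℕ) :
    ((∫ x, ⟪u x, FunctionSpaces.Torus.convect c (FunctionSpaces.Torus.fourierTruncate N v) x⟫_ℝ) +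
        ∫ x, ⟪v x, FunctionSpaces.Torus.convect c (FunctionSpaces.Torus.fourierTruncate N u) x⟫_ℝ =
      (∫ x, ⟪u x - FunctionSpaces.Torus.fourierTruncate N u x,
          FunctionSpaces.Torus.convect c (FunctionSpaces.Torus.fourierTruncate N v) x⟫_ℝ) +
        ∫ x, ⟪v x - FunctionSpaces.Torus.fourierTruncate N v x,
          FunctionSpaces.Torus.convect c (FunctionSpaces.Torus.fourierTruncate N u) x⟫_ℝ) ∧
    |(∫ x, ⟪u x - FunctionSpaces.Torus.fourierTruncate N u x,
          FunctionSpaces.Torus.convect c (FunctionSpaces.Torus.fourierTruncate N v) x⟫_ℝ) +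
        ∫ x, ⟪v x - FunctionSpaces.Torus.fourierTruncate N v x,
          FunctionSpaces.Torus.convect c (FunctionSpaces.Torus.fourierTruncate N u) x⟫_ℝ| ≤
      Fintype.card d * M *
        (Real.sqrt (∫ x, ‖u x - FunctionSpaces.Torus.fourierTruncate N u x‖ ^ 2) *
            Real.sqrt ((FunctionSpaces.Torus.eGradNormSq (FunctionSpaces.Torus.fourierTruncate N v)).toReal) +
          Real.sqrt (∫ x, ‖v x - FunctionSpaces.Torus.fourierTruncate N v x‖ ^ 2) *
            Real.sqrt ((FunctionSpaces.Torus.eGradNormSq (FunctionSpaces.Torus.fourierTruncate N u)).toReal)) := by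
  set Pu := FunctionSpaces.Torus.fourierTruncate N u with hPu
  set Pv := FunctionSpaces.Torus.fourierTruncate N v with hPv
  have hPus : FunctionSpaces.Torus.IsSmooth Pu := FunctionSpaces.Torus.isSmooth_fourierTruncate N u
  have hPvs : FunctionSpaces.Torus.IsSmooth Pv := FunctionSpaces.Torus.isSmooth_fourierTruncate N v
  have hcPu : ∀ j, Integrable (fun x => c x j • Pu x) volume := integrable_smul_of_continuous₁₀ hc hPus.continuous
  have hcPv : ∀ j, Integrable (fun x => c x j • Pv x) volume := integrable_smul_of_continuous₁₀ hc hPvs.continuous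
  have i1 := integrable_inner_convect_of_integrable_smul hcu hPvs
  have i2 := integrable_inner_convect_of_integrable_smul hcPu hPvs
  have i3 := integrable_inner_convect_of_integrable_smul hcv' hPus
  have i4 := integrable_inner_convect_of_integrable_smul hcPv hPus
  have hanti := integral_inner_convect_add_swap_eq_zero hc hcdiv hPus hPvs
  have e1 : ∫ x, ⟪u x - Pu x, FunctionSpaces.Torus.convect c Pv x⟫_ℝ =
      (∫ x, ⟪u x, FunctionSpaces.Torus.convect c Pv x⟫_ℝ) - ∫ x, ⟪Pu x, FunctionSpaces.Torus.convect c Pv x⟫_ℝ := by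
    simp_rw [inner_sub_left]
    exact integral_sub i1 i2
  have e2 : ∫ x, ⟪v x - Pv x, FunctionSpaces.Torus.convect c Pu x⟫_ℝ =
      (∫ x, ⟪v x, FunctionSpaces.Torus.convect c Pu x⟫_ℝ) - ∫ x, ⟪Pv x, FunctionSpaces.Torus.convect c Pu x⟫_ℝ := by
    simp_rw [inner_sub_left]
    exact integral_sub i3 i4
  have heq : (∫ x, ⟪u x, FunctionSpaces.Torus.convect c Pv x⟫_ℝ) + ∫ x, ⟪v x, FunctionSpaces.Torus.convect c Pu x⟫_ℝ =
      (∫ x, ⟪u x - Pu x, FunctionSpaces.Torus.convect c Pv x⟫_ℝ) + ∫ x, ⟪v x - Pv x, FunctionSpaces.Torus.convect c Pu x⟫_ℝ := by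
    rw [e1, e2]; linarith
  refine ⟨heq, ?_⟩
  have hu' : MemLp (fun x => u x - Pu x) 2 volume := hu.sub (FunctionSpaces.Torus.memLp_fourierTruncate N u 2)
  have hv' : MemLp (fun x => v x - Pv x) 2 volume := hv.sub (FunctionSpaces.Torus.memLp_fourierTruncate N v 2)
  have b1 := abs_integral_inner_convect_le_of_norm_le (u := c) hu' hM hcM hPvs
  have b2 := abs_integral_inner_convect_le_of_norm_le (u := c) hv' hM hcM hPus
  rw [hPv, gradNormSq_fourierTruncate] at b1
  rw [hPu, gradNormSq_fourierTruncate] at b2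
  calc |(∫ x, ⟪u x - Pu x, FunctionSpaces.Torus.convect c Pv x⟫_ℝ) + ∫ x, ⟪v x - Pv x, FunctionSpaces.Torus.convect c Pu x⟫_ℝ|
      ≤ |∫ x, ⟪u x - Pu x, FunctionSpaces.Torus.convect c Pv x⟫_ℝ| + |∫ x, ⟪v x - Pv x, FunctionSpaces.Torus.convect c Pu x⟫_ℝ| :=
        abs_add_le _ _
    _ ≤ _ := by
        have := add_le_add b1 b2
        refine this.trans_eq ?_
        rw [hPu, hPv]
        ring

end Flux

/-! ## The duality pairing is constant -/

section Duality

omit [Fintype d] [DecidableEq d] in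
/-- **Cauchy–Schwarz for square roots**: `∫ √f √g ≤ √(∫ f) √(∫ g)` for nonnegative integrable `f, g`.
[folklore] -/
private theorem integral_sqrt_mul_sqrt_le₁₀ {α : Type*} [MeasurableSpace α] {μ : Measure α} {f g : α → ℝ}
    (hf : Integrable f μ) (hg : Integrable g μ) (hf0 : 0 ≤ᵐ[μ] f) (hg0 : 0 ≤ᵐ[μ] g) :
    ∫ x, Real.sqrt (f x) * Real.sqrt (g x) ∂μ ≤ Real.sqrt (∫ x, f x ∂μ) * Real.sqrt (∫ x, g x ∂μ) := by
  have hmem : ∀ {φ : α → ℝ}, Integrable φ μ → 0 ≤ᵐ[μ] φ →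
      MemLp (fun x => Real.sqrt (φ x)) (ENNReal.ofReal 2) μ := by
    intro φ hφ hφ0
    rw [show ENNReal.ofReal 2 = 2 by simp]
    refine (memLp_two_iff_integrable_sq (Real.continuous_sqrt.comp_aestronglyMeasurable hφ.1)).2 ?_
    refine hφ.congr ?_
    filter_upwards [hφ0] with x hx
    rw [Real.sq_sqrt hx]
  have h := integral_mul_le_Lp_mul_Lq_of_nonneg Real.HolderConjugate.two_two
    (ae_of_all _ fun x => Real.sqrt_nonneg (f x)) (ae_of_all _ fun x => Real.sqrt_nonneg (g x)) (hmem hf hf0) (hmem hg hg0)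
  have e1 : ∫ x, Real.sqrt (f x) ^ (2 : ℝ) ∂μ = ∫ x, f x ∂μ := by
    refine integral_congr_ae ?_
    filter_upwards [hf0] with x hx
    rw [Real.rpow_two, Real.sq_sqrt hx]
  have e2 : ∫ x, Real.sqrt (g x) ^ (2 : ℝ) ∂μ = ∫ x, g x ∂μ := by
    refine integral_congr_ae ?_
    filter_upwards [hg0] with x hx
    rw [Real.rpow_two, Real.sq_sqrt hx]
  rw [e1, e2] at h
  simpa [Real.sqrt_eq_rpow] using h

omit [Fintype d] [DecidableEq d] in
/-- `∫_{(0,s₂]} f − ∫_{(0,s₁]} f = ∫_{(s₁,s₂]} f` for `0 ≤ s₁ ≤ s₂` and `f` integrable on `(0,s₂]`.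
[folklore] -/
private theorem setIntegral_Ioc_sub_setIntegral_Ioc₁₀ {E : Type*} [NormedAddCommGroup E] [NormedSpace ℝ E]
    {f : ℝ → E} {s₁ s₂ : ℝ} (hf : IntegrableOn f (Ioc 0 s₂)) (h1 : 0 ≤ s₁) (h12 : s₁ ≤ s₂) :
    (∫ σ in Ioc 0 s₂, f σ) - ∫ σ in Ioc 0 s₁, f σ = ∫ σ in Ioc s₁ s₂, f σ := by
  have hab : IntervalIntegrable f volume 0 s₂ := by
    rw [intervalIntegrable_iff, uIoc_of_le (h1.trans h12)]; exact hf
  have hac : IntervalIntegrable f volume 0 s₁ := by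
    rw [intervalIntegrable_iff, uIoc_of_le h1]; exact hf.mono_set (Ioc_subset_Ioc_right h12)
  rw [← intervalIntegral.integral_of_le (h1.trans h12), ← intervalIntegral.integral_of_le h1,
    ← intervalIntegral.integral_of_le h12, intervalIntegral.integral_interval_sub_left hab hac]

omit [DecidableEq d] in
/-- `(−c·∇)Ψ = −(c·∇)Ψ` pointwise. [folklore] -/
private theorem convect_neg_carrier₁₀ (c : UnitAddTorus d → EuclideanSpace ℝ d)
    (Ψ : UnitAddTorus d → EuclideanSpace ℝ d) (x : UnitAddTorus d) :
    FunctionSpaces.Torus.convect (-c) Ψ x = -FunctionSpaces.Torus.convect c Ψ x := by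
  simp only [FunctionSpaces.Torus.convect, Pi.neg_apply, map_neg]

omit [Fintype d] [DecidableEq d] in
/-- An a.e. upper bound for a function continuous on `[0,t₀]`, `0 < t₀`, holds everywhere on `[0,t₀]`
(an open subinterval on which it fails would have positive measure; the endpoints by closure).
[folklore] -/
private theorem le_of_ae_le_of_continuousOn₁₀ {f : ℝ → ℝ} {t₀ c : ℝ} (ht₀ : 0 < t₀)
    (hf : ContinuousOn f (Icc 0 t₀)) (h : ∀ᵐ s ∂(volume.restrict (Ioo 0 t₀)), f s ≤ c) :
    ∀ s ∈ Icc 0 t₀, f s ≤ c := by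
  have hopen : ∀ s ∈ Ioo 0 t₀, f s ≤ c := by
    intro s hs
    by_contra hlt
    rw [not_le] at hlt
    have hca : ContinuousAt f s := hf.continuousAt (Icc_mem_nhds hs.1 hs.2)
    have hev : ∀ᶠ y in 𝓝 s, c < f y := hca.eventually (lt_mem_nhds hlt)
    obtain ⟨δ, hδ, hball⟩ := Metric.eventually_nhds_iff_ball.1 (hev.and (Ioo_mem_nhds hs.1 hs.2))
    have h' : ∀ᵐ y ∂(volume : Measure ℝ), y ∈ Ioo 0 t₀ → f y ≤ c := (ae_restrict_iff' measurableSet_Ioo).1 h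
    have hnull : volume {y : ℝ | ¬ (y ∈ Ioo 0 t₀ → f y ≤ c)} = 0 := ae_iff.1 h'
    have hsub : Metric.ball s δ ⊆ {y : ℝ | ¬ (y ∈ Ioo 0 t₀ → f y ≤ c)} := by
      intro y hy
      have := hball y hy
      simp only [mem_setOf_eq, Classical.not_imp, not_le]
      exact ⟨this.2, this.1⟩
    have h0 : volume (Metric.ball s δ) = 0 := measure_mono_null hsub hnull
    rw [Real.volume_ball] at h0
    have : (0 : ℝ≥0∞) < ENNReal.ofReal (2 * δ) := ENNReal.ofReal_pos.2 (by linarith)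
    exact this.ne' h0
  intro s hs
  have hcl : closure (Ioo (0 : ℝ) t₀) = Icc 0 t₀ := closure_Ioo ht₀.ne
  have hfc : ContinuousOn f (closure (Ioo 0 t₀)) := by rwa [hcl]
  have himg : f '' closure (Ioo 0 t₀) ⊆ closure (f '' Ioo 0 t₀) := hfc.image_closure
  have hmem : f s ∈ closure (f '' Ioo 0 t₀) := himg ⟨s, by rwa [hcl], rfl⟩
  have hsub : f '' Ioo 0 t₀ ⊆ Iic c := by
    rintro _ ⟨y, hy, rfl⟩
    exact hopen y hy
  have := (closure_mono hsub) hmem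
  rwa [isClosed_Iic.closure_eq, mem_Iic] at this

omit [DecidableEq d] in
/-- **The time-reversed carrier is again essentially bounded**: if `stLift b ∈ L^∞((0,T) × T^d)` and
`0 < t₀ ≤ T` then `stLift (r ↦ −b(t₀ − r)) ∈ L^∞((0,t₀) × T^d)` (composition with the
measure-preserving reflection `(r, y) ↦ (t₀ − r, y)`), so the adjoint problem on `(0,t₀)` has the
carrier regularity required by `PassiveVectorTensorLionsExistence.exists_isWeakTensorPassiveVectorOn`.
[cite: Temam1984, Ch. III §1 Lemma 1.2] -/
theorem memLp_top_stLift_reversed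
    {b : ℝ → UnitAddTorus d → EuclideanSpace ℝ d} {T t₀ : ℝ}
    (hb : MemLp (FunctionSpaces.Torus.stLift b) ∞ (volume.restrict (Ioo 0 T ×ˢ univ)))
    (ht₀T : t₀ ≤ T) :
    MemLp (FunctionSpaces.Torus.stLift (fun r => -b (t₀ - r))) ∞ (volume.restrict (Ioo 0 t₀ ×ˢ univ)) := by
  set θ : ℝ × EuclideanSpace ℝ d → ℝ × EuclideanSpace ℝ d := fun p => (t₀ - p.1, p.2) with hθ
  have hθmp : MeasurePreserving θ (volume : Measure (ℝ × EuclideanSpace ℝ d)) volume := by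
    have h := (measurePreserving_sub_left₁₀ t₀).prod (MeasurePreserving.id (volume : Measure (EuclideanSpace ℝ d)))
    have e : Prod.map (fun s : ℝ => t₀ - s) id = θ := by
      funext p; rfl
    rw [e] at h
    exact h
  have hpre : θ ⁻¹' (Ioo 0 t₀ ×ˢ univ) = Ioo 0 t₀ ×ˢ univ := by
    ext p
    simp only [hθ, mem_preimage, mem_prod, mem_univ, and_true, mem_Ioo]
    constructor <;> rintro ⟨h1, h2⟩ <;> constructor <;> linarith
  have hθr : MeasurePreserving θ (volume.restrict (Ioo 0 t₀ ×ˢ univ)) (volume.restrict (Ioo 0 t₀ ×ˢ univ)) := by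
    have h := hθmp.restrict_preimage (measurableSet_Ioo.prod MeasurableSet.univ) (s := Ioo 0 t₀ ×ˢ univ)
    rwa [hpre] at h
  have hb₀ : MemLp (FunctionSpaces.Torus.stLift b) ∞ (volume.restrict (Ioo 0 t₀ ×ˢ univ)) :=
    hb.mono_measure (Measure.restrict_mono (prod_mono (Ioo_subset_Ioo le_rfl ht₀T) le_rfl) le_rfl)
  have hcomp : MemLp (FunctionSpaces.Torus.stLift b ∘ θ) ∞ (volume.restrict (Ioo 0 t₀ ×ˢ univ)) :=
    hb₀.comp_measurePreserving hθr
  have e : FunctionSpaces.Torus.stLift (fun r => -b (t₀ - r)) = -(FunctionSpaces.Torus.stLift b ∘ θ) := by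
    funext p
    simp only [FunctionSpaces.Torus.stLift, hθ, Function.comp_apply, Pi.neg_apply]
  rw [e]
  exact hcomp.neg

namespace IsWeakTensorPassiveVectorOn

variable {T t₀ : ℝ} {𝔸 : Visc4 d} {b u ψ : ℝ → UnitAddTorus d → EuclideanSpace ℝ d}
  {u₀ φ : UnitAddTorus d → EuclideanSpace ℝ d}

/-- **The duality pairing of a weak solution with a weak solution of the adjoint problem is
constant in time.** Let `u` be a weak tensor-viscosity passive solenoidal vector on `(0,T)` with
tensor `𝔸`, carrier `b` and datum `u₀` (`∂ₜu + (b·∇)u + ∇π = 𝓛_𝔸 u`, `∇·u = 0`), and, for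
`0 < t₀ ≤ T`, let `ψ` be a weak solution on `(0,t₀)` of the SAME CLASS with the transposed tensor
`𝔸ᵀ = majorTranspose 𝔸`, the time-reversed carrier `r ↦ −b(t₀ − r)` and datum `φ` (the adjoint
problem, written forward in `r = t₀ − s`). Assume `NearIso 𝔸 lo hi` with `0 < lo`, both carriers
(i.e. `b` essentially bounded) and both data in `L²` and weakly divergence free. Then the pairing
`s ↦ ∫⟪u(s), ψ(t₀ − s)⟫` is a.e. equal to a constant on `(0,t₀)`.
Proof (Temam's Lemma III.1.2, polarised, in Fourier–Galerkin form): expand each mode in an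
orthonormal basis of `k^⊥`, where the tested modes are absolutely continuous (`ae_inner_mFourierCoeff_eq`
for `u` and for `ψ`, the latter reflected in time); the product formula for primitives gives
`d/ds Σ_{|k|≤N} Re⟪û(s)(k), ψ̂(t₀−s)(k)⟫ = ` (viscous terms, which cancel mode by mode because
`T_{𝔸ᵀ}(k)` is the adjoint of `T_𝔸(k)`) `+ ∫⟪u,(b·∇)P_Nψ(t₀−·)⟫ + ∫⟪ψ(t₀−·),(b·∇)P_N u⟫`, and the
transport flux is a remainder `O(‖u − P_Nu‖₂‖∇P_Nψ‖₂ + ‖ψ − P_Nψ‖₂‖∇P_N u‖₂)` by antisymmetry,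
whose `L¹(0,t₀)` norm tends to `0` (Parseval tails, finite dissipations); Parseval identifies the
limit of the truncated pairings with `∫⟪u(s), ψ(t₀−s)⟫` at a.e. `s`.
[cite: Temam1984, Ch. III §1 Lemma 1.2] [cite: Frisch1995Turbulence, §9.6.3 eq. (9.57) p. 233] -/
theorem exists_ae_integral_inner_reversed_eq_const (hu : IsWeakTensorPassiveVectorOn 0 T 𝔸 b u₀ u)
    (ht₀ : 0 < t₀) (ht₀T : t₀ ≤ T)
    (hψ : IsWeakTensorPassiveVectorOn 0 t₀ (majorTranspose 𝔸) (fun r => -b (t₀ - r)) φ ψ)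
    {lo hi : ℝ} (h𝔸 : NearIso 𝔸 lo hi) (hlo : 0 < lo)
    (hu₀ : MemLp u₀ 2 volume) (hdivu₀ : FunctionSpaces.Torus.IsWeaklyDivFree u₀)
    (hφ : MemLp φ 2 volume) (hdivφ : FunctionSpaces.Torus.IsWeaklyDivFree φ)
    (hb : MemLp (FunctionSpaces.Torus.stLift b) ∞ (volume.restrict (Ioo 0 T ×ˢ univ))) :
    ∃ c : ℝ, ∀ᵐ s ∂(volume.restrict (Ioo 0 t₀)), ∫ x, ⟪u s x, ψ (t₀ - s) x⟫_ℝ = c := by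
  classical
  have hb' : MemLp (FunctionSpaces.Torus.stLift (fun r => -b (t₀ - r))) ∞ (volume.restrict (Ioo 0 t₀ ×ˢ univ)) :=
    memLp_top_stLift_reversed hb ht₀T
  have hu₀i : Integrable u₀ volume := hu₀.integrable one_le_two
  have hφi : Integrable φ volume := hφ.integrable one_le_two
  have hsubT : Ioo 0 t₀ ⊆ Ioo 0 T := Ioo_subset_Ioo le_rfl ht₀T
  have h𝔸' : NearIso (majorTranspose 𝔸) lo hi := (nearIso_majorTranspose_iff 𝔸 lo hi).2 h𝔸
  -- ### notation: modes, mode right-hand sides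
  set Xu : (d → ℤ) → ℝ → EuclideanSpace ℂ d := fun k s =>
    mFourierCoeff (FunctionSpaces.EuclideanSpace.complexify ∘ u s) k with hXu
  set Xψ : (d → ℤ) → ℝ → EuclideanSpace ℂ d := fun k r =>
    mFourierCoeff (FunctionSpaces.EuclideanSpace.complexify ∘ ψ r) k with hXψ
  set X₀ : (d → ℤ) → EuclideanSpace ℂ d := fun k =>
    mFourierCoeff (FunctionSpaces.EuclideanSpace.complexify ∘ u₀) k with hX₀
  set Φ₀ : (d → ℤ) → EuclideanSpace ℂ d := fun k =>
    mFourierCoeff (FunctionSpaces.EuclideanSpace.complexify ∘ φ) k with hΦ₀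
  set Hu : (d → ℤ) → EuclideanSpace ℂ d → ℝ → ℂ := fun k z σ =>
    (-(4 * Real.pi ^ 2 : ℝ) : ℂ) * ⟪Xu k σ, symbT 𝔸 k z⟫_ℂ +
      ((∑ j, (2 * Real.pi * I * (k j)) *
          ⟪mFourierCoeff (FunctionSpaces.EuclideanSpace.complexify ∘ fun x => b σ x j • u σ x) k, z⟫_ℂ) +
        ((0 : ℝ) : ℂ) * ∑ j, (2 * Real.pi * I * (k j)) *
          ⟪mFourierCoeff (FunctionSpaces.EuclideanSpace.complexify ∘ fun x => u σ x j • b σ x) k, z⟫_ℂ) with hHu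
  set Hψ : (d → ℤ) → EuclideanSpace ℂ d → ℝ → ℂ := fun k z r =>
    (-(4 * Real.pi ^ 2 : ℝ) : ℂ) * ⟪Xψ k r, symbT (majorTranspose 𝔸) k z⟫_ℂ +
      ((∑ j, (2 * Real.pi * I * (k j)) *
          ⟪mFourierCoeff (FunctionSpaces.EuclideanSpace.complexify ∘ fun x => (-b (t₀ - r)) x j • ψ r x) k, z⟫_ℂ) +
        ((0 : ℝ) : ℂ) * ∑ j, (2 * Real.pi * I * (k j)) *
          ⟪mFourierCoeff (FunctionSpaces.EuclideanSpace.complexify ∘ fun x => ψ r x j • (-b (t₀ - r)) x) k, z⟫_ℂ) with hHψ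
  have hHui : ∀ k z, IntegrableOn (Hu k z) (Ioo 0 T) volume := fun k z => hu.integrableOn_modeRHS k z
  have hHψi : ∀ k z, IntegrableOn (Hψ k z) (Ioo 0 t₀) volume := fun k z => hψ.integrableOn_modeRHS k z
  -- ### orthonormal bases of the transversal subspaces
  set S : (d → ℤ) → Submodule ℂ (EuclideanSpace ℂ d) := fun k =>
    (ℂ ∙ (WithLp.toLp 2 (fun j => ((k j : ℤ) : ℂ)) : EuclideanSpace ℂ d))ᗮ with hS
  set e : (k : d → ℤ) → Fin (Module.finrank ℂ (S k)) → EuclideanSpace ℂ d :=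
    fun k i => ((stdOrthonormalBasis ℂ (S k)) i : EuclideanSpace ℂ d) with he
  have he_tr : ∀ k i, ∑ j, (k j : ℂ) * e k i j = 0 := fun k i =>
    (mem_orthogonal_waveVec_iff k _).1 ((stdOrthonormalBasis ℂ (S k)) i).2
  -- ### the absolutely continuous representatives of the tested modes
  set α : (k : d → ℤ) → Fin (Module.finrank ℂ (S k)) → ℝ → ℂ := fun k i s =>
    ⟪X₀ k, e k i⟫_ℂ + ∫ σ in Ioc 0 s, Hu k (e k i) σ with hα
  set β : (k : d → ℤ) → Fin (Module.finrank ℂ (S k)) → ℝ → ℂ := fun k i r =>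
    ⟪Φ₀ k, e k i⟫_ℂ + ∫ ρ in Ioc 0 r, Hψ k (e k i) ρ with hβ
  set p : (d → ℤ) → ℝ → ℂ := fun k s => ∑ i, α k i s * conj (β k i (t₀ - s)) with hp
  set q : (d → ℤ) → ℝ → ℂ := fun k σ =>
    ∑ i, (Hu k (e k i) σ * conj (β k i (t₀ - σ)) + α k i σ * -conj (Hψ k (e k i) (t₀ - σ))) with hq
  -- ### Claim A: the truncated pairing representatives are primitives
  have hA : ∀ k, IntegrableOn (q k) (Ioc 0 t₀) volume ∧
      ∀ s₁ s₂, 0 < s₁ → s₁ ≤ s₂ → s₂ ≤ t₀ → p k s₂ - p k s₁ = ∫ σ in Ioc s₁ s₂, q k σ := by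
    intro k
    -- per basis vector
    have hi : ∀ i, ∀ t ∈ Ioc 0 t₀,
        IntegrableOn (fun σ => Hu k (e k i) σ * conj (β k i (t₀ - σ)) + α k i σ * -conj (Hψ k (e k i) (t₀ - σ))) (Ioc 0 t) volume ∧
        α k i t * conj (β k i (t₀ - t)) = ⟪X₀ k, e k i⟫_ℂ * conj (β k i t₀) +
          ∫ σ in Ioc 0 t, (Hu k (e k i) σ * conj (β k i (t₀ - σ)) + α k i σ * -conj (Hψ k (e k i) (t₀ - σ))) := by
      intro i t ht
      have hφI : IntegrableOn (Hu k (e k i)) (Ioo 0 t₀) volume := (hHui k (e k i)).mono_set hsubT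
      have hγ0 : IntegrableOn (fun σ => Hψ k (e k i) (t₀ - σ)) (Ioo 0 t₀) volume :=
        integrableOn_comp_sub_left (hHψi k (e k i))
      have hγI : IntegrableOn (fun σ => -conj (Hψ k (e k i) (t₀ - σ))) (Ioo 0 t₀) volume := by
        have h1 : IntegrableOn (fun σ => Complex.conjCLE (Hψ k (e k i) (t₀ - σ))) (Ioo 0 t₀) volume :=
          Complex.conjCLE.toContinuousLinearMap.integrable_comp hγ0
        simp only [Complex.conjCLE_apply] at h1
        exact h1.neg
      refine mul_eq_add_setIntegral_of_eq_add_setIntegral_complex (T := t₀) (F := α k i)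
        (G := fun s => conj (β k i (t₀ - s))) hφI hγI (fun t _ => rfl) (fun t' ht' => ?_) ht
      -- the reflected primitive
      show conj (β k i (t₀ - t')) = conj (β k i t₀) + ∫ σ in Ioc 0 t', -conj (Hψ k (e k i) (t₀ - σ))
      have hrefl := setIntegral_Ioc_sub_eq (hHψi k (e k i)) (s := t') ⟨ht'.1.le, ht'.2⟩
      simp only [hβ]
      rw [hrefl]
      simp only [map_add, map_neg, ← integral_conj]
      ring
    refine ⟨?_, fun s₁ s₂ hs₁ hs₁₂ hs₂ => ?_⟩
    · exact integrable_finsetSum _ fun i _ => (hi i t₀ ⟨ht₀, le_rfl⟩).1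
    · have hs₂I : s₂ ∈ Ioc 0 t₀ := ⟨hs₁.trans_le hs₁₂, hs₂⟩
      have hs₁I : s₁ ∈ Ioc 0 t₀ := ⟨hs₁, hs₁₂.trans hs₂⟩
      have hdiff : ∀ i, α k i s₂ * conj (β k i (t₀ - s₂)) - α k i s₁ * conj (β k i (t₀ - s₁)) =
          ∫ σ in Ioc s₁ s₂, (Hu k (e k i) σ * conj (β k i (t₀ - σ)) + α k i σ * -conj (Hψ k (e k i) (t₀ - σ))) := by
        intro i
        rw [(hi i s₂ hs₂I).2, (hi i s₁ hs₁I).2, add_sub_add_left_eq_sub,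
          setIntegral_Ioc_sub_setIntegral_Ioc₁₀ (hi i s₂ hs₂I).1 hs₁.le hs₁₂]
      rw [hp, hq]
      simp only
      rw [← Finset.sum_sub_distrib, integral_finsetSum _ fun i _ => ?_]
      · exact Finset.sum_congr rfl fun i _ => hdiff i
      · exact ((hi i t₀ ⟨ht₀, le_rfl⟩).1).mono_set (Ioc_subset_Ioc hs₁.le hs₂)
  -- ### local algebra in the bases `e k`
  have honb : ∀ k (X : EuclideanSpace ℂ d), X ∈ S k → ∑ i, conj ⟪X, e k i⟫_ℂ • e k i = X :=
    fun k X hX => sum_conj_inner_smul_onb₁₀ (stdOrthonormalBasis ℂ (S k)) hX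
  have hpair : ∀ k (X Y : EuclideanSpace ℂ d), Y ∈ S k → ∑ i, ⟪X, e k i⟫_ℂ * conj ⟪Y, e k i⟫_ℂ = ⟪X, Y⟫_ℂ :=
    fun k X Y hY => sum_inner_mul_conj_inner_onb₁₀ (stdOrthonormalBasis ℂ (S k)) X hY
  have hHu_lin : ∀ k σ (μ : Fin (Module.finrank ℂ (S k)) → ℂ),
      Hu k (∑ i, μ i • e k i) σ = ∑ i, μ i * Hu k (e k i) σ := fun k σ μ =>
    modeRHS_sum_smul₁₀ Finset.univ 𝔸 k 0 (Xu k σ)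
      (fun j => mFourierCoeff (FunctionSpaces.EuclideanSpace.complexify ∘ fun x => b σ x j • u σ x) k)
      (fun j => mFourierCoeff (FunctionSpaces.EuclideanSpace.complexify ∘ fun x => u σ x j • b σ x) k) μ (e k)
  have hHψ_lin : ∀ k r (μ : Fin (Module.finrank ℂ (S k)) → ℂ),
      Hψ k (∑ i, μ i • e k i) r = ∑ i, μ i * Hψ k (e k i) r := fun k r μ =>
    modeRHS_sum_smul₁₀ Finset.univ (majorTranspose 𝔸) k 0 (Xψ k r)
      (fun j => mFourierCoeff (FunctionSpaces.EuclideanSpace.complexify ∘ fun x => (-b (t₀ - r)) x j • ψ r x) k)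
      (fun j => mFourierCoeff (FunctionSpaces.EuclideanSpace.complexify ∘ fun x => ψ r x j • (-b (t₀ - r)) x) k) μ (e k)
  -- ### a.e. facts in `σ ∈ (0,t₀)`: the representatives are the tested modes, which are transversal
  have hB1u : ∀ᵐ σ ∂(volume.restrict (Ioo 0 t₀)), ∀ k, ∀ i, α k i σ = ⟪Xu k σ, e k i⟫_ℂ := by
    have h : ∀ᵐ σ ∂(volume.restrict (Ioo 0 T)), ∀ k, ∀ i, ⟪Xu k σ, e k i⟫_ℂ = α k i σ :=
      ae_all_iff.2 fun k => ae_all_iff.2 fun i => hu.ae_inner_mFourierCoeff_eq hu₀i k (he_tr k i)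
    exact (ae_restrict_of_ae_restrict_of_subset hsubT h).mono fun σ hσ k i => (hσ k i).symm
  have hB2u : ∀ᵐ σ ∂(volume.restrict (Ioo 0 t₀)), ∀ k, Xu k σ ∈ S k := by
    have h : ∀ᵐ σ ∂(volume.restrict (Ioo 0 T)), ∀ k : d → ℤ, ∑ j, (k j : ℂ) * Xu k σ j = 0 :=
      ae_all_iff.2 fun k => hu.ae_sum_mul_mFourierCoeff_eq_zero k
    exact (ae_restrict_of_ae_restrict_of_subset hsubT h).mono fun σ hσ k =>
      (mem_orthogonal_waveVec_iff k _).2 (hσ k)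
  have hB1ψ : ∀ᵐ σ ∂(volume.restrict (Ioo 0 t₀)), ∀ k, ∀ i, β k i (t₀ - σ) = ⟪Xψ k (t₀ - σ), e k i⟫_ℂ := by
    have h : ∀ᵐ r ∂(volume.restrict (Ioo 0 t₀)), ∀ k, ∀ i, ⟪Xψ k r, e k i⟫_ℂ = β k i r :=
      ae_all_iff.2 fun k => ae_all_iff.2 fun i => hψ.ae_inner_mFourierCoeff_eq hφi k (he_tr k i)
    exact (ae_restrict_Ioo_comp_sub_left h).mono fun σ hσ k i => (hσ k i).symm
  have hB2ψ : ∀ᵐ σ ∂(volume.restrict (Ioo 0 t₀)), ∀ k, Xψ k (t₀ - σ) ∈ S k := by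
    have h : ∀ᵐ r ∂(volume.restrict (Ioo 0 t₀)), ∀ k : d → ℤ, ∑ j, (k j : ℂ) * Xψ k r j = 0 :=
      ae_all_iff.2 fun k => hψ.ae_sum_mul_mFourierCoeff_eq_zero k
    exact (ae_restrict_Ioo_comp_sub_left h).mono fun σ hσ k => (mem_orthogonal_waveVec_iff k _).2 (hσ k)
  -- ### Claim B: for a.e. `σ`, `q k σ = H^u_σ(ψ̂(t₀−σ)(k)) − conj H^ψ_{t₀−σ}(û(σ)(k))`
  have hB : ∀ᵐ σ ∂(volume.restrict (Ioo 0 t₀)), ∀ k,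
      q k σ = Hu k (Xψ k (t₀ - σ)) σ - conj (Hψ k (Xu k σ) (t₀ - σ)) := by
    filter_upwards [hB1u, hB2u, hB1ψ, hB2ψ] with σ h1u h2u h1ψ h2ψ k
    have e1 : ∑ i, Hu k (e k i) σ * conj (β k i (t₀ - σ)) = Hu k (Xψ k (t₀ - σ)) σ := by
      calc ∑ i, Hu k (e k i) σ * conj (β k i (t₀ - σ))
          = ∑ i, conj ⟪Xψ k (t₀ - σ), e k i⟫_ℂ * Hu k (e k i) σ :=
            Finset.sum_congr rfl fun i _ => by rw [h1ψ k i, mul_comm]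
        _ = Hu k (∑ i, conj ⟪Xψ k (t₀ - σ), e k i⟫_ℂ • e k i) σ := (hHu_lin k σ _).symm
        _ = Hu k (Xψ k (t₀ - σ)) σ := by rw [honb k _ (h2ψ k)]
    have e2 : ∑ i, α k i σ * -conj (Hψ k (e k i) (t₀ - σ)) = -conj (Hψ k (Xu k σ) (t₀ - σ)) := by
      calc ∑ i, α k i σ * -conj (Hψ k (e k i) (t₀ - σ))
          = -conj (∑ i, conj ⟪Xu k σ, e k i⟫_ℂ * Hψ k (e k i) (t₀ - σ)) := by
            rw [map_sum, ← Finset.sum_neg_distrib]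
            refine Finset.sum_congr rfl fun i _ => ?_
            rw [h1u k i, map_mul, Complex.conj_conj]
            ring
        _ = -conj (Hψ k (∑ i, conj ⟪Xu k σ, e k i⟫_ℂ • e k i) (t₀ - σ)) := by rw [hHψ_lin k (t₀ - σ)]
        _ = -conj (Hψ k (Xu k σ) (t₀ - σ)) := by rw [honb k _ (h2u k)]
    rw [hq]
    simp only
    rw [Finset.sum_add_distrib, e1, e2]
    ring
  -- ### slice facts for a.e. `σ ∈ (0,t₀)`: `u(σ)`, `ψ(t₀−σ)`, the carrier `b(σ)`
  obtain ⟨M, hM, hbM⟩ := ae_ae_norm_le_of_memLp_top_stLift hb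
  have h3u : ∀ᵐ σ ∂(volume.restrict (Ioo 0 t₀)),
      MemLp (u σ) 2 volume ∧ (∀ j, Integrable (fun x => b σ x j • u σ x) volume) ∧
        Integrable (b σ) volume ∧ FunctionSpaces.Torus.IsWeaklyDivFree (b σ) ∧ (∀ᵐ x ∂volume, ‖b σ x‖ ≤ M) := by
    have h := ae_restrict_of_ae_restrict_of_subset hsubT
      (hu.ae_memLp_two.and (hu.ae_integrable_slice.and (hu.ae_aestronglyMeasurable_slice.and
        (hu.ae_isWeaklyDivFree_carrier.and hbM))))
    refine h.mono fun σ hσ => ?_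
    obtain ⟨h2, hsl, hsm, hdiv, hbs⟩ := hσ
    exact ⟨h2, hsl.2.1, Integrable.of_bound hsm.2 M hbs, hdiv, hbs⟩
  have h3ψ : ∀ᵐ σ ∂(volume.restrict (Ioo 0 t₀)),
      MemLp (ψ (t₀ - σ)) 2 volume ∧ ∀ j, Integrable (fun x => b σ x j • ψ (t₀ - σ) x) volume := by
    have h := ae_restrict_Ioo_comp_sub_left (hψ.ae_memLp_two.and hψ.ae_integrable_slice)
    refine h.mono fun σ hσ => ⟨hσ.1, fun j => ?_⟩
    refine (hσ.2.2.1 j).neg.congr (ae_of_all _ fun x => ?_)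
    simp [sub_sub_cancel, neg_smul]
  -- ### notation: tails, truncated dissipations, the remainder bound
  set tailu : ℕ → ℝ → ℝ := fun N σ =>
    ∫ x, ‖u σ x - FunctionSpaces.Torus.fourierTruncate N (u σ) x‖ ^ 2 with htailu
  set tailψ : ℕ → ℝ → ℝ := fun N r =>
    ∫ x, ‖ψ r x - FunctionSpaces.Torus.fourierTruncate N (ψ r) x‖ ^ 2 with htailψ
  set Du : ℕ → ℝ → ℝ := fun N σ =>
    (FunctionSpaces.Torus.eGradNormSq (FunctionSpaces.Torus.fourierTruncate N (u σ))).toReal with hDu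
  set Dψ : ℕ → ℝ → ℝ := fun N r =>
    (FunctionSpaces.Torus.eGradNormSq (FunctionSpaces.Torus.fourierTruncate N (ψ r))).toReal with hDψ
  set C : ℝ := Fintype.card d * M with hC
  have hC0 : 0 ≤ C := by positivity
  set bound : ℕ → ℝ → ℝ := fun N σ =>
    C * (Real.sqrt (tailu N σ) * Real.sqrt (Dψ N (t₀ - σ)) + Real.sqrt (tailψ N (t₀ - σ)) * Real.sqrt (Du N σ))
    with hbound
  -- ### Claim C: for a.e. `σ`, the summed real parts are the cross flux, a remainder bounded by `bound`
  have hBC : ∀ᵐ σ ∂(volume.restrict (Ioo 0 t₀)), ∀ N,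
      |∑ k ∈ FunctionSpaces.Torus.freqBall N, (q k σ).re| ≤ bound N σ := by
    filter_upwards [hB, h3u, h3ψ] with σ hBσ h3uσ h3ψσ N
    obtain ⟨hu2, hbu, hbint, hbdiv, hbMσ⟩ := h3uσ
    obtain ⟨hψ2, hbψ⟩ := h3ψσ
    have hbψ' : ∀ j, Integrable (fun x => (-b (t₀ - (t₀ - σ))) x j • ψ (t₀ - σ) x) volume := by
      intro j
      refine (hbψ j).neg.congr (ae_of_all _ fun x => ?_)
      simp [sub_sub_cancel, neg_smul]
    -- real parts: the viscous terms cancel (`T_{𝔸ᵀ}(k)` is the adjoint of `T_𝔸(k)`)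
    have hre : ∀ k, (q k σ).re =
        (∑ j, (2 * Real.pi * I * (k j)) *
            ⟪mFourierCoeff (FunctionSpaces.EuclideanSpace.complexify ∘ fun x => b σ x j • u σ x) k,
              Xψ k (t₀ - σ)⟫_ℂ).re -
          (∑ j, (2 * Real.pi * I * (k j)) *
            ⟪mFourierCoeff (FunctionSpaces.EuclideanSpace.complexify ∘ fun x => (-b (t₀ - (t₀ - σ))) x j • ψ (t₀ - σ) x) k,
              Xu k σ⟫_ℂ).re := by
      intro k
      have hadj : (⟪Xψ k (t₀ - σ), symbT (majorTranspose 𝔸) k (Xu k σ)⟫_ℂ).re =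
          (⟪Xu k σ, symbT 𝔸 k (Xψ k (t₀ - σ))⟫_ℂ).re := by
        rw [← inner_conj_symm (Xψ k (t₀ - σ)) (symbT (majorTranspose 𝔸) k (Xu k σ)), Complex.conj_re,
          inner_symbT_majorTranspose_left]
      rw [hBσ k, hHu, hHψ]
      simp only [Complex.sub_re, Complex.conj_re, Complex.add_re, neg_mul, Complex.neg_re, Complex.re_ofReal_mul,
        Complex.ofReal_zero, zero_mul, add_zero]
      rw [hadj]
      ring
    have hsum : ∑ k ∈ FunctionSpaces.Torus.freqBall N, (q k σ).re =
        (∫ x, ⟪u σ x, FunctionSpaces.Torus.convect (b σ)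
            (FunctionSpaces.Torus.fourierTruncate N (ψ (t₀ - σ))) x⟫_ℝ) +
          ∫ x, ⟪ψ (t₀ - σ) x, FunctionSpaces.Torus.convect (b σ)
            (FunctionSpaces.Torus.fourierTruncate N (u σ)) x⟫_ℝ := by
      simp only [hre, Finset.sum_sub_distrib, hXu, hXψ]
      rw [← integral_inner_convect_fourierTruncate_eq_sum hbu (ψ (t₀ - σ)) N,
        ← integral_inner_convect_fourierTruncate_eq_sum hbψ' (u σ) N]
      have hneg : ∫ x, ⟪ψ (t₀ - σ) x, FunctionSpaces.Torus.convect (-b (t₀ - (t₀ - σ)))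
          (FunctionSpaces.Torus.fourierTruncate N (u σ)) x⟫_ℝ =
          -∫ x, ⟪ψ (t₀ - σ) x, FunctionSpaces.Torus.convect (b σ)
            (FunctionSpaces.Torus.fourierTruncate N (u σ)) x⟫_ℝ := by
        rw [sub_sub_cancel, ← integral_neg]
        refine integral_congr_ae (ae_of_all _ fun x => ?_)
        dsimp only
        rw [convect_neg_carrier₁₀, inner_neg_right]
      rw [hneg]
      ring
    obtain ⟨heq, hbd⟩ := integral_inner_convect_fourierTruncate_add_swap hbint hbdiv hM hbMσ hu2 hψ2 hbu hbψ N
    rw [hsum, heq]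
    exact hbd
  -- ### finite dissipations, integrable tails, and the `L¹` smallness of the remainder bound
  have hfin_u : ∫⁻ s in Ioo 0 T, FunctionSpaces.Torus.eGradNormSq (u s) < ⊤ := by
    have hDT := hu.eVectorDissipation_lt_top h𝔸 hlo hu₀ hdivu₀ hb
    unfold eVectorDissipation at hDT
    rcases ENNReal.mul_lt_top_iff.1 hDT with h1 | h1 | h1
    · exact h1.2
    · exact absurd (ENNReal.ofReal_eq_zero.1 h1) (not_le.2 hlo)
    · rw [h1]; exact ENNReal.zero_lt_top
  have hfin_ψ : ∫⁻ r in Ioo 0 t₀, FunctionSpaces.Torus.eGradNormSq (ψ r) < ⊤ := by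
    have hDT := hψ.eVectorDissipation_lt_top h𝔸' hlo hφ hdivφ hb'
    unfold eVectorDissipation at hDT
    rcases ENNReal.mul_lt_top_iff.1 hDT with h1 | h1 | h1
    · exact h1.2
    · exact absurd (ENNReal.ofReal_eq_zero.1 h1) (not_le.2 hlo)
    · rw [h1]; exact ENNReal.zero_lt_top
  set Ku : ℝ := (∫⁻ s in Ioo 0 T, FunctionSpaces.Torus.eGradNormSq (u s)).toReal with hKu
  set Kψ : ℝ := (∫⁻ r in Ioo 0 t₀, FunctionSpaces.Torus.eGradNormSq (ψ r)).toReal with hKψ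
  have hDui : ∀ N, IntegrableOn (Du N) (Ioo 0 T) volume ∧ ∫ s in Ioo 0 T, Du N s ≤ Ku :=
    fun N => hu.integrableOn_toReal_eGradNormSq_fourierTruncate hfin_u N
  have hDψi : ∀ N, IntegrableOn (Dψ N) (Ioo 0 t₀) volume ∧ ∫ r in Ioo 0 t₀, Dψ N r ≤ Kψ :=
    fun N => hψ.integrableOn_toReal_eGradNormSq_fourierTruncate hfin_ψ N
  obtain ⟨htailui, -, -⟩ := hu.galerkin_tail
  obtain ⟨htailψi, -, -⟩ := hψ.galerkin_tail
  have htailu0 : Tendsto (fun N => ∫ s in Ioo 0 T, tailu N s) atTop (𝓝 0) := hu.tendsto_integral_galerkin_tail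
  have htailψ0 : Tendsto (fun N => ∫ r in Ioo 0 t₀, tailψ N r) atTop (𝓝 0) := hψ.tendsto_integral_galerkin_tail
  set Y : ℕ → ℝ := fun N =>
    C * (Real.sqrt (∫ s in Ioo 0 T, tailu N s) * Real.sqrt Kψ + Real.sqrt (∫ r in Ioo 0 t₀, tailψ N r) * Real.sqrt Ku)
    with hY
  have hY0 : Tendsto Y atTop (𝓝 0) := by
    have h1 : Tendsto (fun N => Real.sqrt (∫ s in Ioo 0 T, tailu N s)) atTop (𝓝 0) := by
      have := (Real.continuous_sqrt.tendsto 0).comp htailu0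
      rwa [Real.sqrt_zero] at this
    have h2 : Tendsto (fun N => Real.sqrt (∫ r in Ioo 0 t₀, tailψ N r)) atTop (𝓝 0) := by
      have := (Real.continuous_sqrt.tendsto 0).comp htailψ0
      rwa [Real.sqrt_zero] at this
    have h3 := ((h1.mul_const (Real.sqrt Kψ)).add (h2.mul_const (Real.sqrt Ku))).const_mul C
    rw [zero_mul, zero_mul, add_zero, mul_zero] at h3
    exact h3
  have htail_nn : ∀ (v : UnitAddTorus d → EuclideanSpace ℝ d) N,
      0 ≤ ∫ x, ‖v x - FunctionSpaces.Torus.fourierTruncate N v x‖ ^ 2 := fun v N => integral_nonneg fun x => sq_nonneg _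
  -- Cauchy–Schwarz for the products of square roots on `(0,t₀)`
  have prod_int : ∀ {f g : ℝ → ℝ}, IntegrableOn f (Ioo 0 t₀) volume → IntegrableOn g (Ioo 0 t₀) volume →
      (∀ σ, 0 ≤ f σ) → (∀ σ, 0 ≤ g σ) →
      IntegrableOn (fun σ => Real.sqrt (f σ) * Real.sqrt (g σ)) (Ioo 0 t₀) volume ∧
        ∫ σ in Ioo 0 t₀, Real.sqrt (f σ) * Real.sqrt (g σ) ≤
          Real.sqrt (∫ σ in Ioo 0 t₀, f σ) * Real.sqrt (∫ σ in Ioo 0 t₀, g σ) := by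
    intro f g hf hg hf0 hg0
    have hm : AEStronglyMeasurable (fun σ => Real.sqrt (f σ) * Real.sqrt (g σ)) (volume.restrict (Ioo 0 t₀)) :=
      (Real.continuous_sqrt.comp_aestronglyMeasurable hf.aestronglyMeasurable).mul
        (Real.continuous_sqrt.comp_aestronglyMeasurable hg.aestronglyMeasurable)
    have hfg : IntegrableOn (fun σ => (f σ + g σ) / 2) (Ioo 0 t₀) volume := (hf.add hg).div_const 2
    have hint : IntegrableOn (fun σ => Real.sqrt (f σ) * Real.sqrt (g σ)) (Ioo 0 t₀) volume := by
      refine Integrable.mono' hfg hm (ae_of_all _ fun σ => ?_)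
      rw [Real.norm_eq_abs, abs_of_nonneg (mul_nonneg (Real.sqrt_nonneg _) (Real.sqrt_nonneg _))]
      nlinarith [Real.sq_sqrt (hf0 σ), Real.sq_sqrt (hg0 σ), sq_nonneg (Real.sqrt (f σ) - Real.sqrt (g σ))]
    exact ⟨hint, integral_sqrt_mul_sqrt_le₁₀ hf hg (ae_of_all _ hf0) (ae_of_all _ hg0)⟩
  have hD : ∀ N, IntegrableOn (bound N) (Ioo 0 t₀) volume ∧ ∫ σ in Ioo 0 t₀, bound N σ ≤ Y N := by
    intro N
    have it_u : IntegrableOn (tailu N) (Ioo 0 t₀) volume := (htailui N).mono_set hsubT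
    have iD_u : IntegrableOn (Du N) (Ioo 0 t₀) volume := (hDui N).1.mono_set hsubT
    have it_ψ : IntegrableOn (fun σ => tailψ N (t₀ - σ)) (Ioo 0 t₀) volume := integrableOn_comp_sub_left (htailψi N)
    have iD_ψ : IntegrableOn (fun σ => Dψ N (t₀ - σ)) (Ioo 0 t₀) volume := integrableOn_comp_sub_left (hDψi N).1
    obtain ⟨i1, b1⟩ := prod_int it_u iD_ψ (fun σ => htail_nn (u σ) N) (fun σ => ENNReal.toReal_nonneg)
    obtain ⟨i2, b2⟩ := prod_int it_ψ iD_u (fun σ => htail_nn (ψ (t₀ - σ)) N) (fun σ => ENNReal.toReal_nonneg)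
    have i12 : IntegrableOn (fun σ => Real.sqrt (tailu N σ) * Real.sqrt (Dψ N (t₀ - σ)) +
        Real.sqrt (tailψ N (t₀ - σ)) * Real.sqrt (Du N σ)) (Ioo 0 t₀) volume := i1.add i2
    refine ⟨i12.const_mul C, ?_⟩
    -- compare the four integrals with the global quantities
    have c1 : ∫ σ in Ioo 0 t₀, tailu N σ ≤ ∫ s in Ioo 0 T, tailu N s :=
      setIntegral_mono_set (htailui N) (ae_of_all _ fun σ => htail_nn (u σ) N) hsubT.eventuallyLE
    have c2 : ∫ σ in Ioo 0 t₀, Dψ N (t₀ - σ) ≤ Kψ := by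
      rw [setIntegral_Ioo_comp_sub_left (Dψ N)]; exact (hDψi N).2
    have c3 : ∫ σ in Ioo 0 t₀, tailψ N (t₀ - σ) = ∫ r in Ioo 0 t₀, tailψ N r := setIntegral_Ioo_comp_sub_left (tailψ N)
    have c4 : ∫ σ in Ioo 0 t₀, Du N σ ≤ Ku :=
      (setIntegral_mono_set (hDui N).1 (ae_of_all _ fun σ => ENNReal.toReal_nonneg) hsubT.eventuallyLE).trans (hDui N).2
    have hKψ0 : 0 ≤ Kψ := ENNReal.toReal_nonneg
    have hKu0 : 0 ≤ Ku := ENNReal.toReal_nonneg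
    calc ∫ σ in Ioo 0 t₀, bound N σ
        = C * ((∫ σ in Ioo 0 t₀, Real.sqrt (tailu N σ) * Real.sqrt (Dψ N (t₀ - σ))) +
            ∫ σ in Ioo 0 t₀, Real.sqrt (tailψ N (t₀ - σ)) * Real.sqrt (Du N σ)) := by
          rw [hbound]
          simp only
          rw [integral_const_mul, integral_add i1 i2]
      _ ≤ C * (Real.sqrt (∫ σ in Ioo 0 t₀, tailu N σ) * Real.sqrt (∫ σ in Ioo 0 t₀, Dψ N (t₀ - σ)) +
            Real.sqrt (∫ σ in Ioo 0 t₀, tailψ N (t₀ - σ)) * Real.sqrt (∫ σ in Ioo 0 t₀, Du N σ)) :=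
          mul_le_mul_of_nonneg_left (add_le_add b1 b2) hC0
      _ ≤ Y N := by
          rw [hY]
          refine mul_le_mul_of_nonneg_left (add_le_add ?_ ?_) hC0
          · exact mul_le_mul (Real.sqrt_le_sqrt c1) (Real.sqrt_le_sqrt c2) (Real.sqrt_nonneg _) (Real.sqrt_nonneg _)
          · rw [c3]
            exact mul_le_mul_of_nonneg_left (Real.sqrt_le_sqrt c4) (Real.sqrt_nonneg _)
  -- ### the truncated pairings move by at most `Y N`
  have hRqi : ∀ N, IntegrableOn (fun σ => ∑ k ∈ FunctionSpaces.Torus.freqBall N, (q k σ).re) (Ioo 0 t₀) volume :=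
    fun N => integrable_finsetSum _ fun k _ => ((hA k).1.mono_set Ioo_subset_Ioc_self).re
  have hInt : ∀ N s₁ s₂, 0 < s₁ → s₁ ≤ s₂ → s₂ < t₀ →
      |(∑ k ∈ FunctionSpaces.Torus.freqBall N, (p k s₂).re) - ∑ k ∈ FunctionSpaces.Torus.freqBall N, (p k s₁).re| ≤ Y N := by
    intro N s₁ s₂ h1 h12 h2
    have hsub : Ioc s₁ s₂ ⊆ Ioo 0 t₀ := fun σ hσ => ⟨h1.trans hσ.1, hσ.2.trans_lt h2⟩
    have hsub' : Ioc s₁ s₂ ⊆ Ioc 0 t₀ := fun σ hσ => ⟨h1.trans hσ.1, hσ.2.trans h2.le⟩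
    have hdiff : (∑ k ∈ FunctionSpaces.Torus.freqBall N, (p k s₂).re) - ∑ k ∈ FunctionSpaces.Torus.freqBall N, (p k s₁).re =
        ∫ σ in Ioc s₁ s₂, ∑ k ∈ FunctionSpaces.Torus.freqBall N, (q k σ).re := by
      have hI : ∫ σ in Ioc s₁ s₂, ∑ k ∈ FunctionSpaces.Torus.freqBall N, (q k σ).re =
          ∑ k ∈ FunctionSpaces.Torus.freqBall N, ∫ σ in Ioc s₁ s₂, (q k σ).re :=
        integral_finsetSum _ fun k _ => ((hA k).1.mono_set hsub').re
      rw [hI, ← Finset.sum_sub_distrib]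
      refine Finset.sum_congr rfl fun k _ => ?_
      rw [← Complex.sub_re, (hA k).2 s₁ s₂ h1 h12 h2.le, re_integral_eq ((hA k).1.mono_set hsub')]
    rw [hdiff]
    calc |∫ σ in Ioc s₁ s₂, ∑ k ∈ FunctionSpaces.Torus.freqBall N, (q k σ).re|
        ≤ ∫ σ in Ioc s₁ s₂, |∑ k ∈ FunctionSpaces.Torus.freqBall N, (q k σ).re| := abs_integral_le_integral_abs
      _ ≤ ∫ σ in Ioo 0 t₀, |∑ k ∈ FunctionSpaces.Torus.freqBall N, (q k σ).re| :=
          setIntegral_mono_set (hRqi N).abs (ae_of_all _ fun σ => abs_nonneg _) hsub.eventuallyLE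
      _ ≤ ∫ σ in Ioo 0 t₀, bound N σ := integral_mono_ae (hRqi N).abs (hD N).1 (hBC.mono fun σ hσ => hσ N)
      _ ≤ Y N := (hD N).2
  -- ### Claim E: for a.e. `s`, the truncated pairings converge to `∫⟪u(s), ψ(t₀−s)⟫` (Parseval)
  have hgood : ∀ᵐ s ∂(volume.restrict (Ioo 0 t₀)),
      Tendsto (fun N => ∑ k ∈ FunctionSpaces.Torus.freqBall N, (p k s).re) atTop
        (𝓝 (∫ x, ⟪u s x, ψ (t₀ - s) x⟫_ℝ)) := by
    filter_upwards [hB1u, hB1ψ, hB2ψ, h3u, h3ψ] with s h1u h1ψ h2ψ h3us h3ψs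
    have hP := (FunctionSpaces.Torus.hasSum_re_inner_mFourierCoeff_complexify h3us.1 h3ψs.1).comp
      FunctionSpaces.Torus.tendsto_freqBall_atTop
    refine hP.congr fun N => ?_
    rw [Function.comp_apply]
    refine Finset.sum_congr rfl fun k _ => ?_
    have hk : p k s = ⟪Xu k s, Xψ k (t₀ - s)⟫_ℂ := by
      rw [hp]
      simp only
      rw [← hpair k (Xu k s) (Xψ k (t₀ - s)) (h2ψ k)]
      exact Finset.sum_congr rfl fun i _ => by rw [h1u k i, h1ψ k i]
    rw [hk]
  -- ### conclusion: the pairing is constant on the good set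
  have hμ : (ae (volume.restrict (Ioo (0 : ℝ) t₀))).NeBot := by
    rw [ae_neBot, Ne, Measure.restrict_eq_zero, Real.volume_Ioo, ENNReal.ofReal_eq_zero, not_le]
    linarith
  obtain ⟨s₀, hs₀, hs₀I⟩ := (hgood.and (ae_restrict_mem measurableSet_Ioo)).exists
  refine ⟨∫ x, ⟪u s₀ x, ψ (t₀ - s₀) x⟫_ℝ, ?_⟩
  have key : ∀ {a c : ℝ} {Ga Gc : ℝ}, 0 < a → a ≤ c → c < t₀ →
      Tendsto (fun N => ∑ k ∈ FunctionSpaces.Torus.freqBall N, (p k a).re) atTop (𝓝 Ga) →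
      Tendsto (fun N => ∑ k ∈ FunctionSpaces.Torus.freqBall N, (p k c).re) atTop (𝓝 Gc) → Gc = Ga := by
    intro a c Ga Gc ha hac hc hta htc
    have hsub := htc.sub hta
    have h0 : Tendsto (fun N => (∑ k ∈ FunctionSpaces.Torus.freqBall N, (p k c).re) -
        ∑ k ∈ FunctionSpaces.Torus.freqBall N, (p k a).re) atTop (𝓝 0) :=
      squeeze_zero_norm (fun N => by rw [Real.norm_eq_abs]; exact hInt N a c ha hac hc) hY0
    have := tendsto_nhds_unique hsub h0
    linarith
  filter_upwards [hgood, ae_restrict_mem measurableSet_Ioo] with s hs hsI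
  rcases le_total s s₀ with hle | hle
  · exact (key hsI.1 hle hs₀I.2 hs hs₀).symm
  · exact key hs₀I.1 hle hsI.2 hs₀ hs

/-- **The duality constant is the trace at both ends.** Under the hypotheses of
`exists_ae_integral_inner_reversed_eq_const` the constant `c` of the pairing
`s ↦ ∫⟪u(s), ψ(t₀ − s)⟫` is the value AT `t₀` of the continuous representative of `t ↦ ∫⟪u(t), φ⟫`
(any function continuous on `[0,T]` agreeing with the pairing a.e., e.g. the one of
`PassiveVectorTensorWeakContinuity.exists_continuousOn_integral_inner`) and also the value at `t₀` of
the continuous representative of `r ↦ ∫⟪ψ(r), u₀⟫`: "`⟨u(t₀), φ⟩ = ⟨u₀, ψ(t₀)⟩`". The two limits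
`s ↑ t₀` and `s ↓ 0` use the strong `L²` initial traces of `ψ` and of `u`
(`exists_modulus_integral_norm_sq_sub_of_nearIso`) against the energy bounds of `u` and `ψ`, and an
a.e. inequality between continuous functions holds at the endpoint.
[cite: Temam1984, Ch. III §1 Lemma 1.2 and Lemma 1.4] -/
theorem exists_const_ae_integral_inner_reversed_eq (hu : IsWeakTensorPassiveVectorOn 0 T 𝔸 b u₀ u)
    (ht₀ : 0 < t₀) (ht₀T : t₀ ≤ T)
    (hψ : IsWeakTensorPassiveVectorOn 0 t₀ (majorTranspose 𝔸) (fun r => -b (t₀ - r)) φ ψ)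
    {lo hi : ℝ} (h𝔸 : NearIso 𝔸 lo hi) (hlo : 0 < lo)
    (hu₀ : MemLp u₀ 2 volume) (hdivu₀ : FunctionSpaces.Torus.IsWeaklyDivFree u₀)
    (hφ : MemLp φ 2 volume) (hdivφ : FunctionSpaces.Torus.IsWeaklyDivFree φ)
    (hb : MemLp (FunctionSpaces.Torus.stLift b) ∞ (volume.restrict (Ioo 0 T ×ˢ univ))) :
    ∃ c : ℝ, (∀ᵐ s ∂(volume.restrict (Ioo 0 t₀)), ∫ x, ⟪u s x, ψ (t₀ - s) x⟫_ℝ = c) ∧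
      (∀ g : ℝ → ℝ, ContinuousOn g (Icc 0 T) →
        (∀ᵐ t ∂(volume.restrict (Ioo 0 T)), ∫ x, ⟪u t x, φ x⟫_ℝ = g t) → g t₀ = c) ∧
      (∀ h : ℝ → ℝ, ContinuousOn h (Icc 0 t₀) →
        (∀ᵐ r ∂(volume.restrict (Ioo 0 t₀)), ∫ x, ⟪ψ r x, u₀ x⟫_ℝ = h r) → h t₀ = c) := by
  obtain ⟨c, hc⟩ := hu.exists_ae_integral_inner_reversed_eq_const ht₀ ht₀T hψ h𝔸 hlo hu₀ hdivu₀ hφ hdivφ hb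
  have hsubT : Ioo 0 t₀ ⊆ Ioo 0 T := Ioo_subset_Ioo le_rfl ht₀T
  have h𝔸' : NearIso (majorTranspose 𝔸) lo hi := (nearIso_majorTranspose_iff 𝔸 lo hi).2 h𝔸
  have hb' : MemLp (FunctionSpaces.Torus.stLift (fun r => -b (t₀ - r))) ∞ (volume.restrict (Ioo 0 t₀ ×ˢ univ)) :=
    memLp_top_stLift_reversed hb ht₀T
  -- energy bounds and initial traces of `u` and `ψ`
  have hEu := hu.ae_integral_norm_sq_le h𝔸 hlo hu₀ hdivu₀ hb
  have hEψ := hψ.ae_integral_norm_sq_le h𝔸' hlo hφ hdivφ hb'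
  obtain ⟨ωu, hωuc, hωu0, hωu⟩ := hu.exists_modulus_integral_norm_sq_sub_of_nearIso h𝔸 hlo hu₀ hdivu₀ hb
  obtain ⟨ωψ, hωψc, hωψ0, hωψ⟩ := hψ.exists_modulus_integral_norm_sq_sub_of_nearIso h𝔸' hlo hφ hdivφ hb'
  -- Cauchy–Schwarz for the pairing of a difference (both factors in `L²`)
  have cs : ∀ {v w z : UnitAddTorus d → EuclideanSpace ℝ d}, MemLp v 2 volume → MemLp w 2 volume → MemLp z 2 volume →
      |(∫ x, ⟪v x, z x⟫_ℝ) - ∫ x, ⟪w x, z x⟫_ℝ| ≤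
        Real.sqrt (∫ x, ‖v x - w x‖ ^ 2) * Real.sqrt (∫ x, ‖z x‖ ^ 2) := by
    intro v w z hv hw hz
    have hi1 : Integrable (fun x => ⟪v x, z x⟫_ℝ) volume :=
      Integrable.mono' (hv.norm.integrable_mul hz.norm) (hv.1.inner hz.1) (ae_of_all _ fun _ => norm_inner_le_norm _ _)
    have hi2 : Integrable (fun x => ⟪w x, z x⟫_ℝ) volume :=
      Integrable.mono' (hw.norm.integrable_mul hz.norm) (hw.1.inner hz.1) (ae_of_all _ fun _ => norm_inner_le_norm _ _)
    rw [← integral_sub hi1 hi2]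
    simp_rw [← inner_sub_left]
    have hvw : MemLp (fun x => v x - w x) 2 volume := hv.sub hw
    -- `|∫⟪a, z⟫| ≤ √∫‖a‖² √∫‖z‖²`
    have h1 : |∫ x, ⟪v x - w x, z x⟫_ℝ| ≤ ∫ x, ‖v x - w x‖ * ‖z x‖ := by
      rw [← Real.norm_eq_abs]
      exact (norm_integral_le_integral_norm _).trans (integral_mono_of_nonneg
        (ae_of_all _ fun x => norm_nonneg _) (hvw.norm.integrable_mul hz.norm)
        (ae_of_all _ fun x => norm_inner_le_norm _ _))
    have h2 := integral_mul_le_Lp_mul_Lq_of_nonneg Real.HolderConjugate.two_two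
      (ae_of_all _ fun x => norm_nonneg (v x - w x)) (ae_of_all _ fun x => norm_nonneg (z x))
      (by simpa using hvw.norm) (by simpa using hz.norm)
    refine h1.trans (h2.trans_eq ?_)
    simp only [Real.rpow_two, Real.sqrt_eq_rpow]
  refine ⟨c, hc, fun g hgc hg => ?_, fun h hhc hh => ?_⟩
  · -- `s ↑ t₀`: `|c − g(s)| ≤ √E₀ √ωψ(t₀ − s)` a.e., both sides continuous on `[0,t₀]`
    set E₀ : ℝ := ∫ x, ‖u₀ x‖ ^ 2 with hE₀
    have hae : ∀ᵐ s ∂(volume.restrict (Ioo 0 t₀)),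
        |c - g s| - Real.sqrt E₀ * Real.sqrt (ωψ (t₀ - s)) ≤ 0 := by
      have hu' := ae_restrict_of_ae_restrict_of_subset hsubT ((hu.ae_memLp_two.and hEu).and hg)
      have hψ' := ae_restrict_Ioo_comp_sub_left (hψ.ae_memLp_two.and hωψ)
      filter_upwards [hc, hu', hψ'] with s hcs hus hψs
      obtain ⟨⟨hu2, hEus⟩, hgs⟩ := hus
      obtain ⟨hψ2, hωs⟩ := hψs
      have hb1 := cs hψ2 hφ hu2
      -- `∫⟪u s, ψ(t₀-s)⟫ - ∫⟪u s, φ⟫` written with the first slots swapped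
      have e1 : (∫ x, ⟪ψ (t₀ - s) x, u s x⟫_ℝ) = c := by
        rw [← hcs]; exact integral_congr_ae (ae_of_all _ fun x => real_inner_comm _ _)
      have e2 : (∫ x, ⟪φ x, u s x⟫_ℝ) = g s := by
        rw [← hgs]; exact integral_congr_ae (ae_of_all _ fun x => real_inner_comm _ _)
      rw [e1, e2] at hb1
      have hsq : Real.sqrt (∫ x, ‖u s x‖ ^ 2) ≤ Real.sqrt E₀ := Real.sqrt_le_sqrt hEus
      have hsq' : Real.sqrt (∫ x, ‖ψ (t₀ - s) x - φ x‖ ^ 2) ≤ Real.sqrt (ωψ (t₀ - s)) := Real.sqrt_le_sqrt hωs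
      nlinarith [hb1, hsq, hsq', Real.sqrt_nonneg (∫ x, ‖u s x‖ ^ 2), Real.sqrt_nonneg (ωψ (t₀ - s)),
        Real.sqrt_nonneg (∫ x, ‖ψ (t₀ - s) x - φ x‖ ^ 2), Real.sqrt_nonneg E₀]
    have hcont : ContinuousOn (fun s => |c - g s| - Real.sqrt E₀ * Real.sqrt (ωψ (t₀ - s))) (Icc 0 t₀) := by
      refine ((continuousOn_const.sub (hgc.mono (Icc_subset_Icc le_rfl ht₀T))).abs).sub
        (continuousOn_const.mul ((hωψc.comp (continuousOn_const.sub continuousOn_id) ?_).sqrt))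
      intro s hs
      show t₀ - s ∈ Icc 0 t₀
      exact ⟨by linarith [hs.2], by linarith [hs.1]⟩
    have h0 := le_of_ae_le_of_continuousOn₁₀ ht₀ hcont hae t₀ ⟨ht₀.le, le_rfl⟩
    simp only [sub_self, hωψ0, Real.sqrt_zero, mul_zero, sub_zero] at h0
    have := abs_nonneg (c - g t₀)
    have h00 : |c - g t₀| = 0 := le_antisymm h0 this
    rw [abs_eq_zero, sub_eq_zero] at h00
    exact h00.symm
  · -- `s ↓ 0`: `|c − h(t₀ − s)| ≤ √ωu(s) √Φ₀` a.e., both sides continuous on `[0,t₀]`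
    set F₀ : ℝ := ∫ x, ‖φ x‖ ^ 2 with hF₀
    have hae : ∀ᵐ s ∂(volume.restrict (Ioo 0 t₀)),
        |c - h (t₀ - s)| - Real.sqrt (ωu s) * Real.sqrt F₀ ≤ 0 := by
      have hu' := ae_restrict_of_ae_restrict_of_subset hsubT (hu.ae_memLp_two.and hωu)
      have hψ' := ae_restrict_Ioo_comp_sub_left ((hψ.ae_memLp_two.and hEψ).and hh)
      filter_upwards [hc, hu', hψ'] with s hcs hus hψs
      obtain ⟨hu2, hωs⟩ := hus
      obtain ⟨⟨hψ2, hEψs⟩, hhs⟩ := hψs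
      have hb1 := cs hu2 hu₀ hψ2
      have e2 : (∫ x, ⟪u₀ x, ψ (t₀ - s) x⟫_ℝ) = h (t₀ - s) := by
        rw [← hhs]; exact integral_congr_ae (ae_of_all _ fun x => real_inner_comm _ _)
      rw [hcs, e2] at hb1
      have hsq : Real.sqrt (∫ x, ‖ψ (t₀ - s) x‖ ^ 2) ≤ Real.sqrt F₀ := Real.sqrt_le_sqrt hEψs
      have hsq' : Real.sqrt (∫ x, ‖u s x - u₀ x‖ ^ 2) ≤ Real.sqrt (ωu s) := Real.sqrt_le_sqrt hωs
      nlinarith [hb1, hsq, hsq', Real.sqrt_nonneg (∫ x, ‖ψ (t₀ - s) x‖ ^ 2), Real.sqrt_nonneg (ωu s),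
        Real.sqrt_nonneg (∫ x, ‖u s x - u₀ x‖ ^ 2), Real.sqrt_nonneg F₀]
    have hcont : ContinuousOn (fun s => |c - h (t₀ - s)| - Real.sqrt (ωu s) * Real.sqrt F₀) (Icc 0 t₀) := by
      refine ((continuousOn_const.sub (hhc.comp (continuousOn_const.sub continuousOn_id) ?_)).abs).sub
        (((hωuc.mono (Icc_subset_Icc le_rfl ht₀T)).sqrt).mul continuousOn_const)
      intro s hs
      show t₀ - s ∈ Icc 0 t₀
      exact ⟨by linarith [hs.2], by linarith [hs.1]⟩
    have h0 := le_of_ae_le_of_continuousOn₁₀ ht₀ hcont hae 0 ⟨le_rfl, ht₀.le⟩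
    simp only [sub_zero, hωu0, Real.sqrt_zero, zero_mul] at h0
    have := abs_nonneg (c - h t₀)
    have h00 : |c - h t₀| = 0 := le_antisymm h0 this
    rw [abs_eq_zero, sub_eq_zero] at h00
    exact h00.symm

end IsWeakTensorPassiveVectorOn

omit [Fintype d] [DecidableEq d] in
/-- **An a.e. bound on a pairing passes to its continuous representative at EVERY time**: if `h` is
continuous on `[0,T]`, `0 < T`, and `|h(r)| ≤ B` for a.e. `r ∈ (0,T)`, then `|h(r)| ≤ B` for every
`r ∈ [0,T]` (Temam 1984, Ch. III Lemma 1.4: the `L^∞` bound of a weakly continuous function holds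
at every time). [cite: Temam1984, Ch. III §1 Lemma 1.4] -/
theorem abs_le_of_ae_abs_le_of_continuousOn {h : ℝ → ℝ} {T B : ℝ} (hT : 0 < T)
    (hh : ContinuousOn h (Icc 0 T)) (hB : ∀ᵐ r ∂(volume.restrict (Ioo 0 T)), |h r| ≤ B) :
    ∀ r ∈ Icc 0 T, |h r| ≤ B :=
  le_of_ae_le_of_continuousOn₁₀ hT hh.abs hB

end Duality

end Torus

end Literature.Analysis.FluidPDE

end
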